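import Literature.MathematicalPhysics.QuantumFieldTheory.Balaban1983to89.B4Thm112BoxDeriv
import Literature.MathematicalPhysics.QuantumFieldTheory.Balaban1983to89.B4Thm19BoxHolderUniform
import Literature.MathematicalPhysics.QuantumFieldTheory.Balaban1983to89.B4Delta112ZeroBoxHolder

/-!
# `Balaban1983to89.B4Thm112BoxHolder` — [Balaban1983RegularityDecay] THEOREM p. 573, the `δG` clause (1.11)–(1.12),
# HÖLDER MEMBER (1.9)·(1.12), ON EVERY NESTED PAIR OF BOXES `Ω ⊂ Ω₀`, FOR A (1.7)-REGULAR FIELD, WITH ONLY «e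
# SUFFICIENTLY SMALL»: `|x−x′|^{−α}|U(A(Γ_{x,x′}))(D^η_{A,ν}δG_kf)(x′) − (D^η_{A,ν}δG_kf)(x)|
#   ≤ c_H·exp(−(2K)⁻¹(dist({x,x′},supp f) + dist({x,x′},Ω₀∖Ω) + dist(supp f,Ω₀∖Ω)))·‖f‖_∞` for ALL `x ≠ x′` of `Ω`

statement-level skeleton of published theorems with citation tags; proofs where landed; nothing here is a claim about the Yang–Mills mass gap

CITATION HEADER.  T. Bałaban, *Regularity and decay of lattice Green's functions*, Commun. Math. Phys. **89** (1983)
571–597, doi:10.1007/bf01214744 [Balaban1983RegularityDecay] (cell paper B4; held text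
`paper:balaban1983-cmp89-regularity-decay`, journal page = PDF page + 570; p. 573 Theorem (1.9)–(1.12), p. 579).
Unit `lit-balaban-p17` gen 5 (Phase-2 proof seat p17; HOME `run/shared/lean/pub/lit-balaban/`), SKELETON row
**B4.Thm@573** (clause (1.11)–(1.12), Hölder member, rectangular `Ω ⊂ Ω₀`).  Imports p17 g5 `B4Thm112BoxDeriv` (the
derivative member `thm112_deriv_box_uniform`, the annular machinery `source_facts`/`annular_bound`, `restrV`,
`derivA_restrV_apply`, `derivA_mulH_apply`, `deltaG_decomp_fun`; → `B4Thm112BoxValue`, `B4Thm112BoxIdentity`), p17 g5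
`B4Thm19BoxHolderUniform` (the all-pairs Hölder member (1.9) on a box, `thm19_holder_box_uniform_all`; →
`B4Thm19BoxHolderCut`: `transport_map`, `pathEnd_map`, `nbrs_subEmb_iff`) and the tree's zero-field leaf
`B4Delta112ZeroBoxHolder` (pv17: the Lipschitz bounds of the cutoff and of its bond derivative, `abs_chi_sub_le`,
`abs_dchi_sub_le`; the weights `holderWeight_mul_le_one`, `holderWeight_le_one`).

WHAT IS PRINTED (p. 573).  (1.9): «|x − x′|^{−α}|U(A(Γ_{x,x′}))(D^η_{A,μ}G_k(Ω,A)f)(x′) − (D^η_{A,μ}G_k(Ω,A)f)(x)| ≤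
c₀ exp(−δ₀ dist({x,x′}, supp f))‖f‖_∞»; «If Ω ⊂ Ω₀, then for δG_k(Ω,Ω₀,A) … we have the inequalities (1.9) and (1.10) (with
the same restrictions on x, x′) with the additional factor (1.12) … for rectangular parallelepipeds, the inequalities
hold without any restrictions on the points x, x′».

WHAT THIS MODULE PROVES (all in full).
* §1 `isNNChain_map_subEmb` (a nearest-neighbour chain of `Ω` is one of `Ω₀`), `chain_covariation_local` (covariant
  telescoping along a chain with the bond differences bounded ON THE CHAIN only), `fld_derivA_mulH` (the Leibniz rule in
  vector form), `fld_derivA_restrV` (the covariant derivative of a restricted field, vector form), `fld_sum'`.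
* §2 **`thm112_holder_box_uniform_unifK`** (and its `α`-first corollary `thm112_holder_box_uniform`) — THE HÖLDER
  MEMBER OF (1.9)·(1.12) FOR `δG_k(Ω,Ω₀,A)` ON NESTED BOXES: `∃ K (16 ≤ K, 4 ∣ K) ∀ 0 ≤ α < 1 ∃ c_H > 0 ∀ (c,β) ∃ e₁ > 0`
  such that for every scale, pair of boxes (unit sides
  multiples of `K`), (1.7)-regular `A_c` constant on the `K`-collars of `Ω₀` and `Ω`, `0 < e ≤ e₁`, direction `ν`, sites
  `x ≠ x′` with the bonds `⟨x,x+ηe_ν⟩, ⟨x′,x′+ηe_ν⟩ ⊂ Ω`, ANY nearest-neighbour chain `Γ` of `Ω` from `x` to `x′` with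
  `|Γ| ≤ (d+1)|x′−x|_∞` inside the `|x′−x|_∞`-ball about `x`, source `f` on `Ω` (`|f| ≤ φ`, supported in `P`) and
  `D, D_b, D_f ≥ 0` below the unit-lattice sup-distances from BOTH `x, x′` to `P`, from BOTH to `Ω₀∖Ω`, and from `P` to
  `Ω₀∖Ω`: with `δ = G_k(Ω,A|Ω)f − (G_k(Ω₀,A)Ef)|Ω`,
  `(n/|x′−x|_∞)^α·|U(A(Γ))(D^η_{A,ν}δ)(x′) − (D^η_{A,ν}δ)(x)|_i ≤ c_H·exp(−(D + D_b + D_f)/(2K))·φ`.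
  Far pairs (`|x′−x|_∞ > n`): weight `≤ 1`, the derivative member at `x` and `x′`.  Close pairs: the decomposition
  `B4Thm112BoxDeriv.deltaG_decomp_fun`; the two `G_k(Ω₀)`-terms by the all-pairs Hölder member on `Ω₀` along the image
  chain (the commutator term through `annular_bound` with the functional `src ↦` Hölder quotient of `D_νG₀src`); the term
  `D_ν((1−χ)u)` by the Leibniz rule at `x` and `x′`: `(1−χ(x′⁺))·`Hölder quotient of `D_νu` (member (1.9) on `Ω`),
  `|χ(x⁺)−χ(x′⁺)|·|D_νu(x)|` (Lipschitz cutoff), `|n∂χ(x′)|·|U(Γ)u(x′) − u(x)|` (covariant telescoping with the derivative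
  member on the chain), `|n∂χ(x′) − n∂χ(x)|·|u(x)|` (Lipschitz bond derivative of the cutoff); each weight–size product is
  `η`-uniform, and every non-zero term has a point of `Ω₀∖Ω` within three units of `x`.
HONEST SCOPE.  As `B4Thm112BoxValue`/`B4Thm112BoxDeriv` (route: cutoff–commutator identity; boxes with sides multiples of
`K`; `A` constant on both `K`-collars, G-B4-p17-02; `d ≥ 1`; distances to `Ω₀∖Ω ⊆ Ω^c`; rate `(2K)⁻¹`; `0 ≤ α < 1`).
No `sorry`; no new `Prop` fact; axioms standard.
-/

namespace Literature.MathematicalPhysics.QuantumFieldTheory.Balaban1983to89.B4Thm112BoxHolder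

open Literature.MathematicalPhysics.QuantumFieldTheory.Balaban1983to89.B4Reflection242 (boxDom mem_boxDom nbrs mem_nbrs
  nbrs_comm blk)
open Literature.MathematicalPhysics.QuantumFieldTheory.Balaban1983to89.B4GaugeCovariance
open Literature.MathematicalPhysics.QuantumFieldTheory.Balaban1983to89.B4Commutators25to211 (mulH fld_mulH_mulVec)
open Literature.MathematicalPhysics.QuantumFieldTheory.Balaban1983to89.B4ContourShift (supNorm supNorm_nonneg
  exists_supNorm_eq abs_le_supNorm)
open Literature.MathematicalPhysics.QuantumFieldTheory.Balaban1983to89.B4Lower18 (supNorm_sub_le_one_of_mem_nbrs)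
open Literature.MathematicalPhysics.QuantumFieldTheory.Balaban1983to89.B4Lower18Regular (e1 baseEmb stairContour
  transport_fieldLink)
open Literature.MathematicalPhysics.QuantumFieldTheory.Balaban1983to89.B4Lower18RegularRegion (compField)
open Literature.MathematicalPhysics.QuantumFieldTheory.Balaban1983to89.B4Lemma21Region (siteNorm covDeriv
  fld_covDeriv_mulVec_of_mem)
open Literature.MathematicalPhysics.QuantumFieldTheory.Balaban1983to89.B4Lemma22ReduceZero (Box opA greenA derivA)
open Literature.MathematicalPhysics.QuantumFieldTheory.Balaban1983to89.B4Lemma22Reduce231 (siteNorm_nonneg siteNorm_zero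
  siteNorm_smul siteNorm_add_le)
open Literature.MathematicalPhysics.QuantumFieldTheory.Balaban1983to89.B4Lemma22HolderBox (IsNNChain)
open Literature.MathematicalPhysics.QuantumFieldTheory.Balaban1983to89.B4HolderChainTools (siteNorm_transport_mulVec
  fieldLink_mul_rev one_le_supNorm_of_ne)
open Literature.MathematicalPhysics.QuantumFieldTheory.Balaban1983to89.B4Eq220CommutatorField (kOp)
open Literature.MathematicalPhysics.QuantumFieldTheory.Balaban1983to89.B4Ineq110WalkRoute (mulH_mulVec_apply)
open Literature.MathematicalPhysics.QuantumFieldTheory.Balaban1983to89.B4Green242Bridge (boxNbrs)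
open Literature.MathematicalPhysics.QuantumFieldTheory.Balaban1983to89.B4Delta112ZeroBox (chi two_le_pow)
open Literature.MathematicalPhysics.QuantumFieldTheory.Balaban1983to89.B4Delta112ZeroBoxHolder (abs_chi_sub_le
  abs_dchi_sub_le holderWeight_mul_le_one holderWeight_le_one)
open Literature.MathematicalPhysics.QuantumFieldTheory.Balaban1983to89.B4Thm110ZeroBox (supNorm_sub_le_sub_add_sub)
open Literature.MathematicalPhysics.QuantumFieldTheory.Balaban1983to89.B4TwoRegion120 (supNorm_sub_comm)
open Literature.MathematicalPhysics.QuantumFieldTheory.Balaban1983to89.B4SubBoxCarrier (subEmb inSub inSub_iff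
  subEmb_injective)
open Literature.MathematicalPhysics.QuantumFieldTheory.Balaban1983to89.B4CubeGreenBox (subField)
open Literature.MathematicalPhysics.QuantumFieldTheory.Balaban1983to89.B4BoxCubeGeometry (posR)
open Literature.MathematicalPhysics.QuantumFieldTheory.Balaban1983to89.B4RegionCubeCarrier (compField_add)
open Literature.MathematicalPhysics.QuantumFieldTheory.Balaban1983to89.B4Thm19BoxHolderAll (abs_U_mulVec_apply_le)
open Literature.MathematicalPhysics.QuantumFieldTheory.Balaban1983to89.B4Thm19BoxHolderCut (transport_map pathEnd_map
  nbrs_subEmb_iff)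
open Literature.MathematicalPhysics.QuantumFieldTheory.Balaban1983to89.B4Thm19BoxHolderUniform (thm19_holder_box_uniform_all
  thm19_holder_box_uniform_all_unifK)
open Literature.MathematicalPhysics.QuantumFieldTheory.Balaban1983to89.B4Thm110BoxUniform (thm110_value_box_uniform)
open Literature.MathematicalPhysics.QuantumFieldTheory.Balaban1983to89.B4Thm110BoxDerivUniform (thm110_deriv_box_uniform)
open Literature.MathematicalPhysics.QuantumFieldTheory.Balaban1983to89.B4Thm112BoxIdentity (extV extV_subEmb
  extV_of_not_inSub Layer)
open Literature.MathematicalPhysics.QuantumFieldTheory.Balaban1983to89.B4Thm112BoxValue (chi_eq_zero_of_layer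
  exists_out_of_chi_ne_one hsize_chi exists_coord_of_le_supNorm le_supNorm_of_coord supNorm_subEmb_sub_subEmb
  max_half_mul_le exp_bookkeeping)
open Literature.MathematicalPhysics.QuantumFieldTheory.Balaban1983to89.B4Thm112BoxDeriv (restrV restrV_apply
  subEmb_add_e1 subEmb_add_e1_mem derivA_restrV_apply derivA_mulH_apply deltaG_decomp_fun source_facts annular_bound
  thm112_deriv_box_uniform)
open scoped Matrix

noncomputable section

variable {d : ℕ}

/-! ## §1. Chains across the embedding, local covariant telescoping, vector forms of the Leibniz rule -/

section Tools

variable (ℓ k : ℕ) (Mb Ms o : Fin (d + 1) → ℕ) {ι : Type} [Fintype ι] [DecidableEq ι] (F : OrthFlow ι) (κ : ℝ)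

omit [Fintype ι] [DecidableEq ι] in
/-- a nearest-neighbour chain of `Ω` is a nearest-neighbour chain of `Ω₀` (the contour `Γ_{x,x′}` read in `Ω₀`).
[cite: Balaban1983RegularityDecay, p.573 «Γ_{x,x′} a shortest contour», dictionary] -/
theorem isNNChain_map_subEmb (ho : ∀ i, o i + Ms i ≤ Mb i) :
    ∀ (x : ↥(Box d ℓ k Ms)) (l : List ↥(Box d ℓ k Ms)), IsNNChain x l →
      IsNNChain (subEmb ℓ k Mb Ms o ho x) (l.map (subEmb ℓ k Mb Ms o ho))
  | _, [], _ => trivial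
  | x, y :: l, h => by
      have h' : y.1 ∈ nbrs x.1 ∧ IsNNChain y l := h
      exact ⟨(nbrs_subEmb_iff ℓ k Mb Ms o ho x y).mpr h'.1, isNNChain_map_subEmb ho y l h'.2⟩

/-- **LOCAL COVARIANT TELESCOPING ALONG A CHAIN**: for an antisymmetric configuration `B` and a field `Ψ` whose forward
covariant bond differences are `≤ β` AT THE SITES OF THE CHAIN, `|U(B(Γ))ψ(end) − ψ(start)| ≤ |Γ|·β` (the links are
isometries; `B4HolderChainTools.chain_covariation_le` with the hypothesis localised to the chain).
[cite: Balaban1983RegularityDecay, (2.14) p.577, (1.3)–(1.4) p.572] -/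
theorem chain_covariation_local {R : Finset (Fin (d + 1) → ℤ)} {B : ↥R → ↥R → ℝ} (hB : ∀ u v, B v u = -B u v)
    (Ψ : ↥R × ι → ℝ) {β : ℝ} :
    ∀ (x : ↥R) (l : List ↥R), IsNNChain x l →
      (∀ u, (u = x ∨ u ∈ l) → ∀ (ν : Fin (d + 1)) (ue : ↥R), ue.1 = u.1 + e1 ν →
        siteNorm (fieldLink F κ B u ue *ᵥ fld Ψ ue - fld Ψ u) ≤ β) →
      siteNorm (transport (fieldLink F κ B) x l *ᵥ fld Ψ (pathEnd x l) - fld Ψ x) ≤ l.length * β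
  | x, [], _, _ => by simp [transport, pathEnd, siteNorm_zero]
  | x, y :: l, hl, hβ => by
      have hl' : y.1 ∈ nbrs x.1 ∧ IsNNChain y l := hl
      have ih := chain_covariation_local hB Ψ y l hl'.2
        (fun u hu => hβ u (Or.inr (by rcases hu with rfl | hu; exacts [List.mem_cons_self, List.mem_cons_of_mem _ hu])))
      have hstep : siteNorm (fieldLink F κ B x y *ᵥ fld Ψ y - fld Ψ x) ≤ β := by
        obtain ⟨ν, hν | hν⟩ := mem_nbrs.1 hl'.1
        · exact hβ x (Or.inl rfl) ν y hν
        · have hx : x.1 = y.1 + e1 ν := by rw [hν, e1]; abel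
          have h1 := hβ y (Or.inr List.mem_cons_self) ν x hx
          have hrev : fieldLink F κ B x y *ᵥ fld Ψ y - fld Ψ x
              = -(fieldLink F κ B x y *ᵥ (fieldLink F κ B y x *ᵥ fld Ψ x - fld Ψ y)) := by
            rw [Matrix.mulVec_sub, Matrix.mulVec_mulVec, fieldLink_mul_rev F κ hB x y, Matrix.one_mulVec]
            abel
          rw [hrev, show -(fieldLink F κ B x y *ᵥ (fieldLink F κ B y x *ᵥ fld Ψ x - fld Ψ y))
              = (-1 : ℝ) • (fieldLink F κ B x y *ᵥ (fieldLink F κ B y x *ᵥ fld Ψ x - fld Ψ y)) by simp,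
            siteNorm_smul, abs_neg, abs_one, one_mul]
          show siteNorm (F.U (κ * B x y) *ᵥ _) ≤ β
          rw [B4Lemma22ReduceDeriv.siteNorm_flow]
          exact h1
      have hβ0 : 0 ≤ β := (siteNorm_nonneg _).trans hstep
      -- `U_{xy}(U(Γ')ψ(end) − ψ(y)) + (U_{xy}ψ(y) − ψ(x))`
      have hsplit : transport (fieldLink F κ B) x (y :: l) *ᵥ fld Ψ (pathEnd x (y :: l)) - fld Ψ x
          = fieldLink F κ B x y *ᵥ (transport (fieldLink F κ B) y l *ᵥ fld Ψ (pathEnd y l) - fld Ψ y)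
            + (fieldLink F κ B x y *ᵥ fld Ψ y - fld Ψ x) := by
        rw [transport, pathEnd, Matrix.mulVec_sub, ← Matrix.mulVec_mulVec]
        abel
      rw [hsplit]
      refine (siteNorm_add_le _ _).trans ?_
      have h1 : siteNorm (fieldLink F κ B x y *ᵥ (transport (fieldLink F κ B) y l *ᵥ fld Ψ (pathEnd y l) - fld Ψ y))
          ≤ l.length * β := by
        show siteNorm (F.U (κ * B x y) *ᵥ _) ≤ _
        rw [B4Lemma22ReduceDeriv.siteNorm_flow]
        exact ih
      simp only [List.length_cons, Nat.cast_succ]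
      linarith

omit [Fintype ι] [DecidableEq ι] in
/-- `fld` of a finite sum of fields. [cite: Balaban1983RegularityDecay, (1.9) p.573, dictionary] -/
theorem fld_sum' {X : Type} (s : Finset ℕ) (v : ℕ → X × ι → ℝ) (z : X) :
    fld (∑ m ∈ s, v m) z = ∑ m ∈ s, fld (v m) z := by
  funext j
  simp only [fld_apply, Finset.sum_apply]

/-- the Leibniz rule in vector form: `(D_ν(hΦ))(x) = h(x+e_ν)·(D_νΦ)(x) + n(h(x+e_ν) − h(x))·Φ(x)`.
[cite: Balaban1983RegularityDecay, (1.3) p.572, (2.10) p.576] -/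
theorem fld_derivA_mulH (M : Fin (d + 1) → ℕ) (A : ↥(Box d ℓ k M) → ↥(Box d ℓ k M) → ℝ) (h : ↥(Box d ℓ k M) → ℝ)
    (Φ : ↥(Box d ℓ k M) × ι → ℝ) (ν : Fin (d + 1)) (x : ↥(Box d ℓ k M)) (hx : x.1 + e1 ν ∈ Box d ℓ k M) :
    fld (derivA d F κ ℓ k M A ν *ᵥ (mulH (ι := ι) h *ᵥ Φ)) x
      = h ⟨x.1 + e1 ν, hx⟩ • fld (derivA d F κ ℓ k M A ν *ᵥ Φ) x
        + ((((ℓ + 1) ^ k : ℕ) : ℝ) * (h ⟨x.1 + e1 ν, hx⟩ - h x)) • fld Φ x := by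
  funext i
  simp only [fld_apply, Pi.add_apply, Pi.smul_apply, smul_eq_mul]
  rw [derivA_mulH_apply ℓ k F κ M A h Φ ν x hx i]

/-- the covariant derivative of a restricted field, vector form, on a bond of `Ω`.
[cite: Balaban1983RegularityDecay, (1.3) p.572, (1.11) p.573] -/
theorem fld_derivA_restrV (ho : ∀ i, o i + Ms i ≤ Mb i) (A : ↥(Box d ℓ k Mb) → ↥(Box d ℓ k Mb) → ℝ)
    (w : ↥(Box d ℓ k Mb) × ι → ℝ) (ν : Fin (d + 1)) (x : ↥(Box d ℓ k Ms)) (hx : x.1 + e1 ν ∈ Box d ℓ k Ms) :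
    fld (derivA d F κ ℓ k Ms (subField ℓ k Mb Ms o ho A) ν *ᵥ restrV ℓ k Mb Ms o ho w) x
      = fld (derivA d F κ ℓ k Mb A ν *ᵥ w) (subEmb ℓ k Mb Ms o ho x) := by
  funext i
  simp only [fld_apply]
  exact derivA_restrV_apply ℓ k Mb Ms o F κ ho A w ν x hx i

end Tools

/-! ## §2. The Hölder member of (1.9)·(1.12) for `δG_k(Ω,Ω₀,A)` on nested boxes -/

section Main

variable {ι : Type} [Fintype ι] [DecidableEq ι]

set_option maxHeartbeats 400000 in
/-- (K-before-α form, G-B4-p17-03: quantifiers `∃ K ∀ α ∃ c_H`; the modulus `K` is the product of the members' α-free moduli.)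
**THEOREM p. 573, THE `δG` CLAUSE (1.11)–(1.12), HÖLDER MEMBER, ON EVERY NESTED PAIR OF BOXES, ALL PAIRS `x ≠ x′`,
WITH ONLY «e SUFFICIENTLY SMALL»**.  For `0 ≤ α < 1` there are `K` (`16 ≤ K`, `4 ∣ K`) and `c_H > 0` (depending on
`d`, `ℓ`, `N`, `α`, the flow and the windows only) such that for every `(c, β)` (`β > 0`) there is `e₁ > 0` with: for
every scale `k ≥ 1`, `a ∈ [a₋,a₊]`, `m² ∈ [0,m²₊]`, every pair of boxes `Ω = n·o + Π[0,nMs) ⊂ Ω₀ = Π[0,nMb)` with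
unit sides multiples of `K`, every component field `A_c`, (1.7)-regular on `Ω₀` and constant on the `K`-collars of `Ω₀`
and of `Ω`, every `0 < e ≤ e₁` (coupling `e/n`), every direction `ν` and sites `x ≠ x′` with
`⟨x,x+ηe_ν⟩, ⟨x′,x′+ηe_ν⟩ ⊂ Ω`, every nearest-neighbour chain `Γ` of `Ω` from `x` to `x′` with `|Γ| ≤ (d+1)|x′−x|_∞`
inside the `|x′−x|_∞`-ball about `x`, every source `f` on `Ω` supported in `P` with `|f| ≤ φ`, and all
`D, D_b, D_f ≥ 0` below the unit-lattice sup-distances from both `x, x′` to `P`, from both `x, x′` to `Ω₀ ∖ Ω`, and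
from `P` to `Ω₀ ∖ Ω`: with `δ = G_k(Ω,A|Ω)f − (G_k(Ω₀,A)Ef)|Ω`,
`(n/|x′−x|_∞)^α·|U(A(Γ))(D^η_{A,ν}δ)(x′) − (D^η_{A,ν}δ)(x)|_i ≤ c_H·exp(−(D + D_b + D_f)/(2K))·φ`.
[cite: Balaban1983RegularityDecay, Theorem (1.9), (1.11)–(1.12) p.573; p.579] -/
theorem thm112_holder_box_uniform_unifK (F : OrthFlow ι) {ℓ₁ : ℝ} (hℓ₁ : 0 ≤ ℓ₁)
    (hLip : ∀ t (v : ι → ℝ), ((F.U t - 1) *ᵥ v) ⬝ᵥ ((F.U t - 1) *ᵥ v) ≤ (ℓ₁ * t) ^ 2 * (v ⬝ᵥ v))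
    (d ℓ : ℕ) (hd : 1 ≤ d) (hℓ : 1 ≤ ℓ) (amin aplus m2plus : ℝ) (ha : 0 < amin) :
    ∃ K : ℕ, 16 ≤ K ∧ 4 ∣ K ∧ ∀ (α : ℝ), 0 ≤ α → α < 1 → ∃ cH : ℝ, 0 < cH ∧ ∀ (creg β : ℝ), 0 ≤ creg → 0 < β →
      ∃ e₁ : ℝ, 0 < e₁ ∧ ∀ (k : ℕ), 1 ≤ k → ∀ (hn : 1 ≤ (ℓ + 1) ^ k) (a m2 : ℝ),
      amin ≤ a → a ≤ aplus → 0 ≤ m2 → m2 ≤ m2plus →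
      ∀ (Mb Ms o : Fin (d + 1) → ℕ) (ho : ∀ i, o i + Ms i ≤ Mb i), (∀ i, 1 ≤ Ms i) → (∀ μ, K ∣ Mb μ) →
        (∀ μ, K ∣ Ms μ) →
      ∀ (Ac : (Fin (d + 1) → ℤ) → Fin (d + 1) → ℝ) (e : ℝ), 0 < e → e ≤ e₁ →
        (∀ x ∈ Box d ℓ k Mb, ∀ μ ν : Fin (d + 1),
          |Ac (x + e1 μ) ν - Ac x ν| ≤ creg * e ^ (β - 1) / ((ℓ + 1) ^ k : ℕ)) →
        (∀ w ∈ Box d ℓ k Mb, (∃ μ, w μ < (((ℓ + 1) ^ k : ℕ) : ℤ) * K ∨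
            (((ℓ + 1) ^ k : ℕ) : ℤ) * Mb μ < w μ + (((ℓ + 1) ^ k : ℕ) : ℤ) * K) → ∀ ν, Ac w ν = Ac 0 ν) →
        (∀ w ∈ Box d ℓ k Ms, (∃ μ, w μ < (((ℓ + 1) ^ k : ℕ) : ℤ) * K ∨
            (((ℓ + 1) ^ k : ℕ) : ℤ) * Ms μ < w μ + (((ℓ + 1) ^ k : ℕ) : ℤ) * K) →
          ∀ ν, Ac (w + fun i => (((ℓ + 1) ^ k : ℕ) : ℤ) * (o i : ℤ)) ν
            = Ac (fun i => (((ℓ + 1) ^ k : ℕ) : ℤ) * (o i : ℤ)) ν) →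
      ∀ (ν : Fin (d + 1)) (x x' : ↥(Box d ℓ k Ms)), x.1 + e1 ν ∈ Box d ℓ k Ms → x'.1 + e1 ν ∈ Box d ℓ k Ms →
        x'.1 ≠ x.1 →
      ∀ (l : List ↥(Box d ℓ k Ms)), IsNNChain x l → pathEnd x l = x' →
        (l.length : ℝ) ≤ ((d : ℝ) + 1) * supNorm (x'.1 - x.1) → (∀ z ∈ l, supNorm (z.1 - x.1) ≤ supNorm (x'.1 - x.1)) →
      ∀ (P : ↥(Box d ℓ k Ms) → Prop) [DecidablePred P] (D Db Df : ℝ),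
        0 ≤ D → 0 ≤ Db → 0 ≤ Df →
        (∀ x'', P x'' → ∃ μ, D ≤ |posR ℓ k Ms x μ - posR ℓ k Ms x'' μ|) →
        (∀ x'', P x'' → ∃ μ, D ≤ |posR ℓ k Ms x' μ - posR ℓ k Ms x'' μ|) →
        (∀ y : ↥(Box d ℓ k Mb), ¬ inSub ℓ k Mb Ms o y →
          ∃ μ, Db ≤ |posR ℓ k Mb (subEmb ℓ k Mb Ms o ho x) μ - posR ℓ k Mb y μ|) →
        (∀ y : ↥(Box d ℓ k Mb), ¬ inSub ℓ k Mb Ms o y →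
          ∃ μ, Db ≤ |posR ℓ k Mb (subEmb ℓ k Mb Ms o ho x') μ - posR ℓ k Mb y μ|) →
        (∀ x'', P x'' → ∀ y : ↥(Box d ℓ k Mb), ¬ inSub ℓ k Mb Ms o y →
          ∃ μ, Df ≤ |posR ℓ k Mb (subEmb ℓ k Mb Ms o ho x'') μ - posR ℓ k Mb y μ|) →
      ∀ (f : ↥(Box d ℓ k Ms) × ι → ℝ), (∀ p, ¬ P p.1 → f p = 0) → ∀ (φ : ℝ), 0 ≤ φ → (∀ p, |f p| ≤ φ) →
      ∀ i : ι,
        ((((ℓ + 1) ^ k : ℕ) : ℝ) / supNorm (x'.1 - x.1)) ^ α *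
          |(transport (fieldLink F (e / ((ℓ + 1) ^ k : ℕ))
                (fun u v : ↥(Box d ℓ k Ms) =>
                  compField (fun w => Ac (w + fun i => (((ℓ + 1) ^ k : ℕ) : ℤ) * (o i : ℤ))) u.1 v.1)) x l
              *ᵥ fld (derivA d F (e / ((ℓ + 1) ^ k : ℕ)) ℓ k Ms
                  (fun u v : ↥(Box d ℓ k Ms) =>
                    compField (fun w => Ac (w + fun i => (((ℓ + 1) ^ k : ℕ) : ℤ) * (o i : ℤ))) u.1 v.1) ν
                *ᵥ (greenA d F (e / ((ℓ + 1) ^ k : ℕ)) ℓ k a m2 Ms (baseEmb hn Ms) (stairContour hn Ms)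
                      (fun u v : ↥(Box d ℓ k Ms) =>
                        compField (fun w => Ac (w + fun i => (((ℓ + 1) ^ k : ℕ) : ℤ) * (o i : ℤ))) u.1 v.1) *ᵥ f
                    - restrV ℓ k Mb Ms o ho
                      (greenA d F (e / ((ℓ + 1) ^ k : ℕ)) ℓ k a m2 Mb (baseEmb hn Mb) (stairContour hn Mb)
                        (fun u v : ↥(Box d ℓ k Mb) => compField Ac u.1 v.1) *ᵥ extV ℓ k Mb Ms o f))) x'
            - fld (derivA d F (e / ((ℓ + 1) ^ k : ℕ)) ℓ k Ms
                  (fun u v : ↥(Box d ℓ k Ms) =>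
                    compField (fun w => Ac (w + fun i => (((ℓ + 1) ^ k : ℕ) : ℤ) * (o i : ℤ))) u.1 v.1) ν
                *ᵥ (greenA d F (e / ((ℓ + 1) ^ k : ℕ)) ℓ k a m2 Ms (baseEmb hn Ms) (stairContour hn Ms)
                      (fun u v : ↥(Box d ℓ k Ms) =>
                        compField (fun w => Ac (w + fun i => (((ℓ + 1) ^ k : ℕ) : ℤ) * (o i : ℤ))) u.1 v.1) *ᵥ f
                    - restrV ℓ k Mb Ms o ho
                      (greenA d F (e / ((ℓ + 1) ^ k : ℕ)) ℓ k a m2 Mb (baseEmb hn Mb) (stairContour hn Mb)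
                        (fun u v : ↥(Box d ℓ k Mb) => compField Ac u.1 v.1) *ᵥ extV ℓ k Mb Ms o f))) x) i|
          ≤ cH * Real.exp (-((D + Db + Df) / (2 * K))) * φ := by
  classical
  obtain ⟨K₁, hK₁, h4₁, c₁, hc₁, H₁⟩ := thm112_deriv_box_uniform F hℓ₁ hLip d ℓ hd hℓ amin aplus m2plus ha
  obtain ⟨K₂, hK₂, -, HU₂⟩ := thm19_holder_box_uniform_all_unifK F hℓ₁ hLip d ℓ hd hℓ amin aplus m2plus ha
  obtain ⟨K₃, hK₃, -, cv, hcv, H₃⟩ := thm110_value_box_uniform F hℓ₁ hLip d ℓ hd hℓ amin aplus m2plus ha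
  obtain ⟨K₄, hK₄, -, cd, hcd, H₄⟩ := thm110_deriv_box_uniform F hℓ₁ hLip d ℓ hd hℓ amin aplus m2plus ha
  set K : ℕ := K₁ * K₂ * (K₃ * K₄) with hK
  have hK₃₄ : 1 ≤ K₃ * K₄ := Nat.one_le_iff_ne_zero.mpr (by positivity)
  have hK₁₂ : 1 ≤ K₁ * K₂ := Nat.one_le_iff_ne_zero.mpr (by positivity)
  have hK₁K : K₁ ≤ K := by rw [hK]; nlinarith
  have hK₂K : K₂ ≤ K := by rw [hK]; nlinarith
  have hK₃K : K₃ ≤ K := by rw [hK]; nlinarith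
  have hK₄K : K₄ ≤ K := by rw [hK]; nlinarith
  have hK16 : 16 ≤ K := hK₁.trans hK₁K
  have h4 : 4 ∣ K := by rw [hK, mul_assoc]; exact dvd_mul_of_dvd_left h4₁ _
  have hKr : (0 : ℝ) < K := by exact_mod_cast lt_of_lt_of_le (by norm_num) hK16
  have hmono : ∀ K' : ℕ, 1 ≤ K' → K' ≤ K → ∀ {D' : ℝ}, 0 ≤ D' → Real.exp (-(D' / K')) ≤ Real.exp (-(D' / K)) := by
    intro K' hK'1 hK'K D' hD'
    have hK'r : (0 : ℝ) < K' := by exact_mod_cast hK'1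
    exact Real.exp_le_exp.mpr (neg_le_neg (div_le_div_of_nonneg_left hD' hK'r (by exact_mod_cast hK'K)))
  have hK₁1 : 1 ≤ K₁ := le_trans (by norm_num) hK₁
  have hK₂1 : 1 ≤ K₂ := le_trans (by norm_num) hK₂
  have hK₃1 : 1 ≤ K₃ := le_trans (by norm_num) hK₃
  have hK₄1 : 1 ≤ K₄ := le_trans (by norm_num) hK₄
  -- `e^{−D'/(2K₁)} ≤ e^{−D'/(2K)}`
  have hmono2 : ∀ {D' : ℝ}, 0 ≤ D' → Real.exp (-(D' / (2 * K₁))) ≤ Real.exp (-(D' / (2 * K))) := by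
    intro D' hD'
    have hK₁r : (0 : ℝ) < K₁ := by exact_mod_cast hK₁1
    have : (2 : ℝ) * K₁ ≤ 2 * K := by
      have : (K₁ : ℝ) ≤ K := by exact_mod_cast hK₁K
      linarith only [this]
    exact Real.exp_le_exp.mpr (neg_le_neg (div_le_div_of_nonneg_left hD' (by positivity) this))
  refine ⟨K, hK16, h4, fun α hα0 hα1 => ?_⟩
  obtain ⟨c₂, hc₂, H₂⟩ := HU₂ α hα0 hα1
  -- the constants
  set CK : ℝ := |Real.sqrt (Fintype.card ι) * (16 * ((d : ℝ) + 1) * cd + (64 * ((d : ℝ) + 1) + 2 * aplus) * cv)|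
    with hCK
  have hCK0 : 0 ≤ CK := abs_nonneg _
  set r : ℝ := Real.exp (-(1 / (2 * K))) with hr
  have hr1 : r < 1 := Real.exp_lt_one_iff.mpr (by
    have : 0 < 1 / (2 * (K : ℝ)) := by positivity
    linarith only [this])
  have h1r : 0 < 1 - r := by linarith only [hr1]
  set cT1 : ℝ := (c₂ + 8 * ((d : ℝ) + 1) * cd + 8 * ((d : ℝ) + 1) * Real.sqrt (Fintype.card ι) * cd
      + 128 * ((d : ℝ) + 1) * cv) * Real.exp (4 / K) with hcT1
  set cH : ℝ := ((Fintype.card ι : ℝ) + 1) * c₁ + cT1 + c₂ * Real.exp (1 / K) * CK * Real.exp (4 / K) / (1 - r)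
      + c₂ * Real.exp (2 / K) + 1 with hcH
  have hcH0 : 0 < cH := by positivity
  refine ⟨cH, hcH0, fun creg β' hcreg hβ => ?_⟩
  obtain ⟨e₁', he₁', H₁'⟩ := H₁ creg β' hcreg hβ
  obtain ⟨e₂, he₂, H₂'⟩ := H₂ creg β' hcreg hβ
  obtain ⟨e₃, he₃, H₃'⟩ := H₃ creg β' hcreg hβ
  obtain ⟨e₄, he₄, H₄'⟩ := H₄ creg β' hcreg hβ
  refine ⟨min (min e₁' e₂) (min e₃ e₄), lt_min (lt_min he₁' he₂) (lt_min he₃ he₄), ?_⟩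
  intro k hk hn a m2 ha1 ha2 hm1 hm2 Mb Ms o ho hMs hKMb hKMs Ac e he hle h17 hcol0 hcolΩ ν x x' hxν hx'ν hne l hl hlend
    hlen hlnear P _ D Db Df hD0 hDb0 hDf0 hD hD' hDb hDb' hDf f hfP φ hφ hf i
  -- scale facts
  have hn2 : 2 ≤ (ℓ + 1) ^ k := two_le_pow hℓ hk
  have hnr : (0 : ℝ) < (((ℓ + 1) ^ k : ℕ) : ℝ) := by exact_mod_cast hn
  have hnr1 : (1 : ℝ) ≤ (((ℓ + 1) ^ k : ℕ) : ℝ) := by exact_mod_cast hn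
  have hMb : ∀ i, 1 ≤ Mb i := fun i => le_trans (le_trans (hMs i) (Nat.le_add_left _ _)) (ho i)
  have ha' : 0 < a := lt_of_lt_of_le ha ha1
  have hle₁ : e ≤ e₁' := hle.trans ((min_le_left _ _).trans (min_le_left _ _))
  have hle₂ : e ≤ e₂ := hle.trans ((min_le_left _ _).trans (min_le_right _ _))
  have hle₃ : e ≤ e₃ := hle.trans ((min_le_right _ _).trans (min_le_left _ _))
  have hle₄ : e ≤ e₄ := hle.trans ((min_le_right _ _).trans (min_le_right _ _))
  have hdvd : ∀ K' : ℕ, K' ∣ K → (∀ μ, K' ∣ Mb μ) ∧ (∀ μ, K' ∣ Ms μ) := fun K' hK' =>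
    ⟨fun μ => hK'.trans (hKMb μ), fun μ => hK'.trans (hKMs μ)⟩
  have hd₁ : K₁ ∣ K := by rw [hK, mul_assoc]; exact dvd_mul_right _ _
  have hd₂ : K₂ ∣ K := by rw [hK, mul_comm K₁, mul_assoc]; exact dvd_mul_right _ _
  have hd₃ : K₃ ∣ K := by rw [hK, mul_comm, mul_assoc]; exact dvd_mul_right _ _
  have hd₄ : K₄ ∣ K := by rw [hK, mul_comm, mul_comm K₃, mul_assoc]; exact dvd_mul_right _ _
  -- the translated component field of `Ω`
  set t : Fin (d + 1) → ℤ := fun i => (((ℓ + 1) ^ k : ℕ) : ℤ) * (o i : ℤ) with ht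
  set Ac' : (Fin (d + 1) → ℤ) → Fin (d + 1) → ℝ := fun w => Ac (w + t) with hAc'
  have hsubF : subField ℓ k Mb Ms o ho (fun u v : ↥(Box d ℓ k Mb) => compField Ac u.1 v.1)
      = fun u v : ↥(Box d ℓ k Ms) => compField Ac' u.1 v.1 := by
    funext a' b'
    show compField Ac (subEmb ℓ k Mb Ms o ho a').1 (subEmb ℓ k Mb Ms o ho b').1 = compField Ac' a'.1 b'.1
    have h1 : (subEmb ℓ k Mb Ms o ho a').1 = a'.1 + t := by funext j; simp [subEmb, ht]
    have h2 : (subEmb ℓ k Mb Ms o ho b').1 = b'.1 + t := by funext j; simp [subEmb, ht]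
    rw [h1, h2, compField_add]
  have hmemT : ∀ w ∈ Box d ℓ k Ms, w + t ∈ Box d ℓ k Mb := fun w hw =>
    B4SubBoxCarrier.shift_mem_Box ℓ k Mb Ms o ho ⟨w, hw⟩
  have h17' : ∀ w ∈ Box d ℓ k Ms, ∀ μ ν : Fin (d + 1),
      |Ac' (w + e1 μ) ν - Ac' w ν| ≤ creg * e ^ (β' - 1) / ((ℓ + 1) ^ k : ℕ) := by
    intro w hw μ ν
    have := h17 (w + t) (hmemT w hw) μ ν
    simp only [hAc']
    rw [add_right_comm]
    exact this
  have hcolW : ∀ K' : ℕ, K' ≤ K → ∀ (M : Fin (d + 1) → ℕ) (w : Fin (d + 1) → ℤ),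
      (∃ μ, w μ < (((ℓ + 1) ^ k : ℕ) : ℤ) * K' ∨ (((ℓ + 1) ^ k : ℕ) : ℤ) * M μ < w μ + (((ℓ + 1) ^ k : ℕ) : ℤ) * K') →
      (∃ μ, w μ < (((ℓ + 1) ^ k : ℕ) : ℤ) * K ∨ (((ℓ + 1) ^ k : ℕ) : ℤ) * M μ < w μ + (((ℓ + 1) ^ k : ℕ) : ℤ) * K) := by
    intro K' hK' M w hex
    have hKK : (((ℓ + 1) ^ k : ℕ) : ℤ) * K' ≤ (((ℓ + 1) ^ k : ℕ) : ℤ) * K :=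
      mul_le_mul_of_nonneg_left (by exact_mod_cast hK') (by positivity)
    obtain ⟨μ, hμ | hμ⟩ := hex
    · exact ⟨μ, Or.inl (lt_of_lt_of_le hμ hKK)⟩
    · exact ⟨μ, Or.inr (by linarith only [hμ, hKK])⟩
  have hcol0' : ∀ K' : ℕ, K' ≤ K → ∀ w ∈ Box d ℓ k Mb, (∃ μ, w μ < (((ℓ + 1) ^ k : ℕ) : ℤ) * K' ∨
      (((ℓ + 1) ^ k : ℕ) : ℤ) * Mb μ < w μ + (((ℓ + 1) ^ k : ℕ) : ℤ) * K') → ∀ ν, Ac w ν = Ac 0 ν :=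
    fun K' hK' w hw hex => hcol0 w hw (hcolW K' hK' Mb w hex)
  have hcolΩK : ∀ K' : ℕ, K' ≤ K → ∀ w ∈ Box d ℓ k Ms, (∃ μ, w μ < (((ℓ + 1) ^ k : ℕ) : ℤ) * K' ∨
      (((ℓ + 1) ^ k : ℕ) : ℤ) * Ms μ < w μ + (((ℓ + 1) ^ k : ℕ) : ℤ) * K') →
      ∀ ν, Ac (w + t) ν = Ac t ν :=
    fun K' hK' w hw hex ν => hcolΩ w hw (hcolW K' hK' Ms w hex) ν
  have hcolΩ' : ∀ K' : ℕ, K' ≤ K → ∀ w ∈ Box d ℓ k Ms, (∃ μ, w μ < (((ℓ + 1) ^ k : ℕ) : ℤ) * K' ∨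
      (((ℓ + 1) ^ k : ℕ) : ℤ) * Ms μ < w μ + (((ℓ + 1) ^ k : ℕ) : ℤ) * K') → ∀ ν, Ac' w ν = Ac' 0 ν := by
    intro K' hK' w hw hex ν
    simp only [hAc']
    rw [zero_add]
    exact hcolΩK K' hK' w hw hex ν
  -- abbreviations
  set κ : ℝ := e / ((ℓ + 1) ^ k : ℕ) with hκ
  set AΩ : ↥(Box d ℓ k Ms) → ↥(Box d ℓ k Ms) → ℝ := fun u v => compField Ac' u.1 v.1 with hAΩ
  set A₀ : ↥(Box d ℓ k Mb) → ↥(Box d ℓ k Mb) → ℝ := fun u v => compField Ac u.1 v.1 with hA₀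
  set GΩ := greenA d F κ ℓ k a m2 Ms (baseEmb hn Ms) (stairContour hn Ms) AΩ with hGΩ
  set G₀ := greenA d F κ ℓ k a m2 Mb (baseEmb hn Mb) (stairContour hn Mb) A₀ with hG₀
  set DνΩ := derivA d F κ ℓ k Ms AΩ ν with hDνΩ
  set Dν₀ := derivA d F κ ℓ k Mb A₀ ν with hDν₀
  set u := GΩ *ᵥ f with hu
  set δv := u - restrV ℓ k Mb Ms o ho (G₀ *ᵥ extV ℓ k Mb Ms o f) with hδv
  set T := transport (fieldLink F κ AΩ) x l with hT
  set ex := subEmb ℓ k Mb Ms o ho x with hex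
  set ex' := subEmb ℓ k Mb Ms o ho x' with hex'
  set sN : ℝ := supNorm (x'.1 - x.1) with hsN
  set wt : ℝ := ((((ℓ + 1) ^ k : ℕ) : ℝ) / sN) ^ α with hwt
  set FF : ℝ := Real.exp (-((D + Db + Df) / (2 * K))) with hFF
  have hFF0 : 0 < FF := Real.exp_pos _
  have hs1 : 1 ≤ sN := one_le_supNorm_of_ne hne
  have hs0 : 0 < sN := lt_of_lt_of_le one_pos hs1
  have hwt0 : 0 ≤ wt := Real.rpow_nonneg (div_nonneg hnr.le hs0.le) α
  have hAas : ∀ u' v' : ↥(Box d ℓ k Ms), AΩ v' u' = -AΩ u' v' := fun u' v' =>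
    B4Lemma21Region.compField_rev Ac' u'.1 v'.1
  -- the members used (instantiated after the abbreviations: no abstraction pass over them)
  have D112 := H₁' k hk hn a m2 ha1 ha2 hm1 hm2 Mb Ms o ho hMs (hdvd K₁ hd₁).1 (hdvd K₁ hd₁).2 Ac e he hle₁ h17
    (hcol0' K₁ hK₁K) (hcolΩK K₁ hK₁K)
  have HΩ := H₂' k hk hn a m2 ha1 ha2 hm1 hm2 Ms hMs (hdvd K₂ hd₂).2 Ac' e he hle₂ h17' (hcolΩ' K₂ hK₂K)
  have HΩ₀ := H₂' k hk hn a m2 ha1 ha2 hm1 hm2 Mb hMb (hdvd K₂ hd₂).1 Ac e he hle₂ h17 (hcol0' K₂ hK₂K)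
  have VΩ := H₃' k hk hn a m2 ha1 ha2 hm1 hm2 Ms hMs (hdvd K₃ hd₃).2 Ac' e he hle₃ h17' (hcolΩ' K₃ hK₃K)
  have DΩ := H₄' k hk hn a m2 ha1 ha2 hm1 hm2 Ms hMs (hdvd K₄ hd₄).2 Ac' e he hle₄ h17' (hcolΩ' K₄ hK₄K)
  clear H₁' H₂' H₃' H₄'
  -- image chain facts
  have hexne : ex'.1 ≠ ex.1 := fun h => hne (congrArg Subtype.val (subEmb_injective ℓ k Mb Ms o ho (Subtype.ext h)))
  have hsNe : supNorm (ex'.1 - ex.1) = sN := supNorm_subEmb_sub_subEmb ℓ k Mb Ms o ho x' x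
  have hTe : transport (fieldLink F κ A₀) ex (l.map (subEmb ℓ k Mb Ms o ho)) = T := by
    rw [hT, hex, transport_map]
    congr 1
    funext u' v'
    show fieldLink F κ A₀ (subEmb ℓ k Mb Ms o ho u') (subEmb ℓ k Mb Ms o ho v') = fieldLink F κ AΩ u' v'
    simp only [fieldLink]
    congr 2
    have := congrFun (congrFun hsubF u') v'
    exact this
  have hle' : IsNNChain ex (l.map (subEmb ℓ k Mb Ms o ho)) := isNNChain_map_subEmb ℓ k Mb Ms o ho x l hl
  have hlend' : pathEnd ex (l.map (subEmb ℓ k Mb Ms o ho)) = ex' := by rw [hex, pathEnd_map, hlend]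
  have hlen' : ((l.map (subEmb ℓ k Mb Ms o ho)).length : ℝ) ≤ ((d : ℝ) + 1) * supNorm (ex'.1 - ex.1) := by
    rw [List.length_map, hsNe]; exact hlen
  have hlnear' : ∀ z ∈ l.map (subEmb ℓ k Mb Ms o ho), supNorm (z.1 - ex.1) ≤ supNorm (ex'.1 - ex.1) := by
    intro z hz
    obtain ⟨w, hw, rfl⟩ := List.mem_map.1 hz
    rw [hsNe, hex, supNorm_subEmb_sub_subEmb]
    exact hlnear w hw
  -- the derivative member of `δG` at a site `z ∈ {x, x′}` in vector form
  have hδpt : ∀ (z : ↥(Box d ℓ k Ms)) (hz : z.1 + e1 ν ∈ Box d ℓ k Ms) (j : ι),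
      fld (DνΩ *ᵥ δv) z j = (DνΩ *ᵥ u) (z, j) - (Dν₀ *ᵥ (G₀ *ᵥ extV ℓ k Mb Ms o f)) (subEmb ℓ k Mb Ms o ho z, j) := by
    intro z hz j
    have h1 := derivA_restrV_apply ℓ k Mb Ms o F κ ho A₀ (G₀ *ᵥ extV ℓ k Mb Ms o f) ν z hz j
    rw [hsubF] at h1
    have h2 : fld (DνΩ *ᵥ δv) z j
        = (DνΩ *ᵥ u) (z, j) - (DνΩ *ᵥ restrV ℓ k Mb Ms o ho (G₀ *ᵥ extV ℓ k Mb Ms o f)) (z, j) := by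
      rw [fld_apply, hδv, Matrix.mulVec_sub, Pi.sub_apply]
    rw [h2]
    exact congrArg (fun t : ℝ => (DνΩ *ᵥ u) (z, j) - t) h1
  -- distance tools
  have hDx : ∀ x'', P x'' → D * (((ℓ + 1) ^ k : ℕ) : ℝ) ≤ supNorm (x.1 - x''.1) := fun x'' hx'' => by
    obtain ⟨μ, hμ⟩ := hD x'' hx''; exact le_supNorm_of_coord ℓ k Ms x x'' hμ
  have hDbx : ∀ y : ↥(Box d ℓ k Mb), ¬ inSub ℓ k Mb Ms o y →
      Db * (((ℓ + 1) ^ k : ℕ) : ℝ) ≤ supNorm (ex.1 - y.1) := fun y hy => by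
    obtain ⟨μ, hμ⟩ := hDb y hy; exact le_supNorm_of_coord ℓ k Mb _ y hμ
  have hDfx : ∀ x'', P x'' → ∀ y : ↥(Box d ℓ k Mb), ¬ inSub ℓ k Mb Ms o y →
      Df * (((ℓ + 1) ^ k : ℕ) : ℝ) ≤ supNorm ((subEmb ℓ k Mb Ms o ho x'').1 - y.1) := fun x'' hx'' y hy => by
    obtain ⟨μ, hμ⟩ := hDf x'' hx'' y hy; exact le_supNorm_of_coord ℓ k Mb _ y hμ
  ---------------------------------------------------------------- far pairs
  by_cases hfar : (((ℓ + 1) ^ k : ℕ) : ℝ) < sN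
  · have hw1 : wt ≤ 1 := holderWeight_le_one hs0 hfar.le hα0
    have hb0 : 0 ≤ c₁ * Real.exp (-((D + Db + Df) / (2 * K₁))) * φ := by positivity
    have hx1 := D112 ν x hxν P D Db Df hD0 hDb0 hDf0 hD hDb hDf f hfP φ hφ hf
    have hx2 := D112 ν x' hx'ν P D Db Df hD0 hDb0 hDf0 hD' hDb' hDf f hfP φ hφ hf
    have hV : ∀ j, |fld (DνΩ *ᵥ δv) x j| ≤ c₁ * Real.exp (-((D + Db + Df) / (2 * K₁))) * φ := fun j => by
      rw [hδpt x hxν j]; exact hx1 j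
    have hV' : ∀ j, |fld (DνΩ *ᵥ δv) x' j| ≤ c₁ * Real.exp (-((D + Db + Df) / (2 * K₁))) * φ := fun j => by
      rw [hδpt x' hx'ν j]; exact hx2 j
    have hU : |(T *ᵥ fld (DνΩ *ᵥ δv) x') i| ≤ (Fintype.card ι : ℝ) * (c₁ * Real.exp (-((D + Db + Df) / (2 * K₁))) * φ) := by
      rw [hT, transport_fieldLink]
      exact abs_U_mulVec_apply_le F _ _ hb0 hV' i
    have hdiff : |(T *ᵥ fld (DνΩ *ᵥ δv) x' - fld (DνΩ *ᵥ δv) x) i|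
        ≤ ((Fintype.card ι : ℝ) + 1) * (c₁ * Real.exp (-((D + Db + Df) / (2 * K₁))) * φ) := by
      rw [Pi.sub_apply]
      refine (abs_sub _ _).trans ?_
      have := hV i
      linarith only [hU, this]
    calc wt * |(T *ᵥ fld (DνΩ *ᵥ δv) x' - fld (DνΩ *ᵥ δv) x) i|
        ≤ 1 * (((Fintype.card ι : ℝ) + 1) * (c₁ * Real.exp (-((D + Db + Df) / (2 * K₁))) * φ)) :=
          mul_le_mul hw1 hdiff (abs_nonneg _) zero_le_one
      _ ≤ ((Fintype.card ι : ℝ) + 1) * c₁ * FF * φ := by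
          rw [one_mul, hFF]
          have := hmono2 (by positivity : 0 ≤ D + Db + Df)
          calc ((Fintype.card ι : ℝ) + 1) * (c₁ * Real.exp (-((D + Db + Df) / (2 * K₁))) * φ)
              = ((Fintype.card ι : ℝ) + 1) * c₁ * Real.exp (-((D + Db + Df) / (2 * K₁))) * φ := by ring
            _ ≤ ((Fintype.card ι : ℝ) + 1) * c₁ * Real.exp (-((D + Db + Df) / (2 * K))) * φ :=
                mul_le_mul_of_nonneg_right (mul_le_mul_of_nonneg_left this (by positivity)) hφ
      _ ≤ cH * FF * φ := by
          refine mul_le_mul_of_nonneg_right (mul_le_mul_of_nonneg_right ?_ hFF0.le) hφ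
          rw [hcH]
          have : 0 ≤ cT1 + c₂ * Real.exp (1 / K) * CK * Real.exp (4 / K) / (1 - r) + c₂ * Real.exp (2 / K) + 1 := by
            positivity
          linarith only [this]
  ---------------------------------------------------------------- close pairs
  push Not at hfar   -- sN ≤ n
  have hwle : wt * (sN / (((ℓ + 1) ^ k : ℕ) : ℝ)) ≤ 1 := holderWeight_mul_le_one hs1 hfar hα1.le
  have hxx' : supNorm (x.1 - x'.1) ≤ (((ℓ + 1) ^ k : ℕ) : ℝ) := by rw [supNorm_sub_comm]; exact hfar
  -- the cutoff and the decomposition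
  set χv : ↥(Box d ℓ k Ms) → ℝ := fun z => chi ((ℓ + 1) ^ k) Ms Mb (fun i => (o i : ℤ)) z.1 with hχv
  have hχL : ∀ z, Layer ℓ k Mb Ms o ho z → χv z = 0 := fun z hz => chi_eq_zero_of_layer ℓ k Mb Ms o ho hn z hz
  have hχ01 : ∀ z, 0 ≤ χv z ∧ χv z ≤ 1 := fun z =>
    ⟨B4Delta112ZeroBox.chi_nonneg _ _ _ _ _, B4Delta112ZeroBox.chi_le_one _ _ _ _ _⟩
  have hsz := hsize_chi ℓ k Mb Ms o hn2 hMs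
  have hdec := deltaG_decomp_fun ℓ k Mb Ms o F κ ho hℓ hk hn ha' hm1 A₀ χv hχL f
  rw [hsubF] at hdec
  set g := kOp F κ ((ℓ + 1) ^ k) (B1.aSeq a ((ℓ : ℝ) + 1) k) m2 Ms (baseEmb hn Ms) (stairContour hn Ms) AΩ χv *ᵥ u
    with hg
  set f₃ := mulH (ι := ι) (fun z => 1 - χv z) *ᵥ f with hf₃
  set hh : ↥(Box d ℓ k Ms) → ℝ := fun z => 1 - χv z with hhh
  -- `fld (D_ν δ) z = fld (D_ν(hh·u)) z − fld (D₀(G₀Eg)) (ez) − fld (D₀(G₀Ef₃)) (ez)` at `z ∈ {x, x′}`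
  have hfldz : ∀ (z : ↥(Box d ℓ k Ms)) (hz : z.1 + e1 ν ∈ Box d ℓ k Ms),
      fld (DνΩ *ᵥ δv) z = fld (DνΩ *ᵥ (mulH (ι := ι) hh *ᵥ u)) z
        - fld (Dν₀ *ᵥ (G₀ *ᵥ extV ℓ k Mb Ms o g)) (subEmb ℓ k Mb Ms o ho z)
        - fld (Dν₀ *ᵥ (G₀ *ᵥ extV ℓ k Mb Ms o f₃)) (subEmb ℓ k Mb Ms o ho z) := by
    intro z hz
    have h1 : δv = mulH (ι := ι) hh *ᵥ u - restrV ℓ k Mb Ms o ho (G₀ *ᵥ extV ℓ k Mb Ms o g)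
        - restrV ℓ k Mb Ms o ho (G₀ *ᵥ extV ℓ k Mb Ms o f₃) := hdec
    have hr1 := fld_derivA_restrV ℓ k Mb Ms o F κ ho A₀ (G₀ *ᵥ extV ℓ k Mb Ms o g) ν z hz
    have hr2 := fld_derivA_restrV ℓ k Mb Ms o F κ ho A₀ (G₀ *ᵥ extV ℓ k Mb Ms o f₃) ν z hz
    rw [hsubF] at hr1 hr2
    rw [h1, Matrix.mulVec_sub, Matrix.mulVec_sub, ← hr1, ← hr2]
    funext j
    simp only [fld_apply, Pi.sub_apply]
    rfl
  -- the three quotients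
  set V1 := fld (DνΩ *ᵥ (mulH (ι := ι) hh *ᵥ u)) with hV1
  set W2 := fld (Dν₀ *ᵥ (G₀ *ᵥ extV ℓ k Mb Ms o g)) with hW2
  set W3 := fld (Dν₀ *ᵥ (G₀ *ᵥ extV ℓ k Mb Ms o f₃)) with hW3
  have hLHS : (T *ᵥ fld (DνΩ *ᵥ δv) x' - fld (DνΩ *ᵥ δv) x) i
      = (T *ᵥ V1 x' - V1 x) i - (T *ᵥ W2 ex' - W2 ex) i - (T *ᵥ W3 ex' - W3 ex) i := by
    rw [hfldz x hxν, hfldz x' hx'ν]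
    simp only [Matrix.mulVec_sub, Pi.sub_apply]
    ring
  rw [hLHS]
  -- witnesses near `x` force `D_b ≤ 3` and `dist(x, P) ≥ (D_f − 3)n`
  set Dc : ℝ := max ((D + (Df - 3)) / 2) 0 with hDc
  have hDc0 : 0 ≤ Dc := le_max_right _ _
  set DA : ℝ := max (Dc - 1) 0 with hDA
  have hDA0 : 0 ≤ DA := le_max_right _ _
  have hbook : (∃ y : ↥(Box d ℓ k Mb), ¬ inSub ℓ k Mb Ms o y ∧ supNorm (ex.1 - y.1) ≤ 3 * (((ℓ + 1) ^ k : ℕ) : ℝ)) →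
      Db ≤ 3 ∧ (∀ x'', P x'' → Dc * (((ℓ + 1) ^ k : ℕ) : ℝ) ≤ supNorm (x.1 - x''.1)) ∧
        (∀ z : ↥(Box d ℓ k Ms), supNorm (x.1 - z.1) ≤ (((ℓ + 1) ^ k : ℕ) : ℝ) →
          ∀ x'', P x'' → DA * (((ℓ + 1) ^ k : ℕ) : ℝ) ≤ supNorm (z.1 - x''.1)) := by
    rintro ⟨y, hy, hdy⟩
    have hDcx : ∀ x'', P x'' → Dc * (((ℓ + 1) ^ k : ℕ) : ℝ) ≤ supNorm (x.1 - x''.1) := by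
      intro x'' hx''
      refine max_half_mul_le hnr.le (hDx x'' hx'') ?_ (supNorm_nonneg _)
      have t1 := supNorm_sub_le_sub_add_sub (subEmb ℓ k Mb Ms o ho x'').1 ex.1 y.1
      rw [hex, supNorm_subEmb_sub_subEmb, supNorm_sub_comm x''.1] at t1
      have := hDfx x'' hx'' y hy
      rw [sub_mul]
      linarith only [t1, this, hdy]
    refine ⟨?_, hDcx, ?_⟩
    · have := (hDbx y hy).trans hdy
      exact le_of_mul_le_mul_right (by linarith only [this]) hnr
    · intro z hz x'' hx''
      have t1 := supNorm_sub_le_sub_add_sub x.1 z.1 x''.1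
      have h1 := hDcx x'' hx''
      have hDA' : DA * (((ℓ + 1) ^ k : ℕ) : ℝ) ≤ max ((Dc - 1) * (((ℓ + 1) ^ k : ℕ) : ℝ)) 0 := by
        rw [hDA]
        rcases le_total (Dc - 1) 0 with hc | hc
        · rw [max_eq_right hc, zero_mul]; exact le_max_right _ _
        · rw [max_eq_left hc]; exact le_max_left _ _
      refine hDA'.trans (max_le ?_ (supNorm_nonneg _))
      rw [sub_mul, one_mul]
      linarith only [t1, h1, hz]
  have hwit : ∀ z : ↥(Box d ℓ k Ms), supNorm (x.1 - z.1) ≤ 2 * (((ℓ + 1) ^ k : ℕ) : ℝ) → χv z ≠ 1 →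
      ∃ y : ↥(Box d ℓ k Mb), ¬ inSub ℓ k Mb Ms o y ∧ supNorm (ex.1 - y.1) ≤ 3 * (((ℓ + 1) ^ k : ℕ) : ℝ) := by
    intro z hz hχz
    obtain ⟨y, hy, hd'⟩ := exists_out_of_chi_ne_one ℓ k Mb Ms o ho hn2 hMs z hχz
    refine ⟨y, hy, ?_⟩
    have t1 := supNorm_sub_le_sub_add_sub ex.1 (subEmb ℓ k Mb Ms o ho z).1 y.1
    rw [hex, supNorm_subEmb_sub_subEmb] at t1
    rw [hex]
    linarith only [t1, hd', hz]
  -- the four relevant sites are within `2n` of `x`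
  set xp : ↥(Box d ℓ k Ms) := ⟨x.1 + e1 ν, hxν⟩ with hxp
  set xp' : ↥(Box d ℓ k Ms) := ⟨x'.1 + e1 ν, hx'ν⟩ with hxp'
  have hnx : supNorm (x.1 - x.1) ≤ 2 * (((ℓ + 1) ^ k : ℕ) : ℝ) := by
    rw [sub_self, B4BoxCov237.supNorm_zero']; positivity
  have hnxp : supNorm (x.1 - xp.1) ≤ 2 * (((ℓ + 1) ^ k : ℕ) : ℝ) := by
    have := supNorm_sub_le_one_of_mem_nbrs (mem_nbrs.2 ⟨ν, Or.inl rfl⟩ : xp.1 ∈ nbrs x.1)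
    linarith only [this, hnr1]
  have hnx' : supNorm (x.1 - x'.1) ≤ 2 * (((ℓ + 1) ^ k : ℕ) : ℝ) := by linarith only [hxx', hnr.le]
  have hxpxp' : supNorm (xp'.1 - xp.1) = sN := by
    rw [hsN]; congr 1; simp only [hxp, hxp']; abel
  have hnxp' : supNorm (x.1 - xp'.1) ≤ 2 * (((ℓ + 1) ^ k : ℕ) : ℝ) := by
    have t1 := supNorm_sub_le_sub_add_sub x.1 x'.1 xp'.1
    have t2 : supNorm (x'.1 - xp'.1) ≤ 1 :=
      supNorm_sub_le_one_of_mem_nbrs (mem_nbrs.2 ⟨ν, Or.inl rfl⟩ : xp'.1 ∈ nbrs x'.1)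
    linarith only [t1, t2, hxx', hnr1]
  -- bookkeeping of the exponentials: `e^{−Dc/K'} ≤ e^{3/K}F`, `e^{−DA/K'} ≤ e^{4/K}F` once `Db ≤ 3`
  have hexpc : Db ≤ 3 → ∀ K' : ℕ, 1 ≤ K' → K' ≤ K → Real.exp (-(Dc / K')) ≤ Real.exp (4 / K) * FF := by
    intro hDb3 K' hK'1 hK'K
    refine (hmono K' hK'1 hK'K hDc0).trans (exp_bookkeeping hKr ?_)
    have : (D + (Df - 3)) / 2 ≤ Dc := le_max_left _ _
    linarith only [this, hDb3]
  have hexpA : Db ≤ 3 → ∀ K' : ℕ, 1 ≤ K' → K' ≤ K → Real.exp (-(DA / K')) ≤ Real.exp (4 / K) * FF := by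
    intro hDb3 K' hK'1 hK'K
    refine (hmono K' hK'1 hK'K hDA0).trans (exp_bookkeeping hKr ?_)
    have h1 : (D + (Df - 3)) / 2 ≤ Dc := le_max_left _ _
    have h2 : Dc - 1 ≤ DA := le_max_left _ _
    linarith only [h1, h2, hDb3]
  ---------------------------------------------------------------- T1'' : the Leibniz terms
  have hT1 : wt * |(T *ᵥ V1 x' - V1 x) i| ≤ cT1 * FF * φ := by
    -- Leibniz at `x` and `x′`
    have hLx : V1 x = hh xp • fld (DνΩ *ᵥ u) x + ((((ℓ + 1) ^ k : ℕ) : ℝ) * (hh xp - hh x)) • fld u x := by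
      rw [hV1, hDνΩ]; exact fld_derivA_mulH ℓ k F κ Ms AΩ hh u ν x hxν
    have hLx' : V1 x' = hh xp' • fld (DνΩ *ᵥ u) x' + ((((ℓ + 1) ^ k : ℕ) : ℝ) * (hh xp' - hh x')) • fld u x' := by
      rw [hV1, hDνΩ]; exact fld_derivA_mulH ℓ k F κ Ms AΩ hh u ν x' hx'ν
    set aa : ℝ := hh xp with haa
    set aa' : ℝ := hh xp' with haa'
    set bb : ℝ := (((ℓ + 1) ^ k : ℕ) : ℝ) * (hh xp - hh x) with hbb
    set bb' : ℝ := (((ℓ + 1) ^ k : ℕ) : ℝ) * (hh xp' - hh x') with hbb'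
    set Vu := fld (DνΩ *ᵥ u) with hVu
    set Uu := fld u with hUu
    have hsplit : T *ᵥ V1 x' - V1 x
        = aa' • (T *ᵥ Vu x' - Vu x) + (aa' - aa) • Vu x + bb' • (T *ᵥ Uu x' - Uu x) + (bb' - bb) • Uu x := by
      rw [hLx, hLx', Matrix.mulVec_add, Matrix.mulVec_smul, Matrix.mulVec_smul]
      module
    rw [hsplit]
    simp only [Pi.add_apply, Pi.smul_apply, smul_eq_mul]
    -- (A)
    have hA : wt * |aa' * (T *ᵥ Vu x' - Vu x) i| ≤ c₂ * Real.exp (4 / K) * FF * φ := by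
      by_cases h0 : aa' = 0
      · rw [h0, zero_mul, abs_zero, mul_zero]; positivity
      have hχ1 : χv xp' ≠ 1 := fun h => h0 (by rw [haa', hhh]; simp only [h, sub_self])
      obtain ⟨hDb3, -, hfarA⟩ := hbook (hwit xp' hnxp' hχ1)
      have hDAx : ∀ x'', P x'' → ∃ μ, DA ≤ |posR ℓ k Ms x μ - posR ℓ k Ms x'' μ| := fun x'' hx'' =>
        exists_coord_of_le_supNorm ℓ k Ms x x'' (hfarA x (by rw [sub_self, B4BoxCov237.supNorm_zero']; exact hnr.le) x'' hx'')
      have hDAx' : ∀ x'', P x'' → ∃ μ, DA ≤ |posR ℓ k Ms x' μ - posR ℓ k Ms x'' μ| := fun x'' hx'' =>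
        exists_coord_of_le_supNorm ℓ k Ms x' x'' (hfarA x' hxx' x'' hx'')
      have hH := HΩ ν x x' hxν hx'ν hne l hl hlend hlen hlnear P DA hDA0 hDAx hDAx' f hfP φ hφ hf i
      have haa1 : |aa'| ≤ 1 := by
        rw [haa', hhh]; obtain ⟨h0', h1'⟩ := hχ01 xp'
        rw [abs_of_nonneg (by linarith only [h1'])]; linarith only [h0']
      rw [abs_mul]
      calc wt * (|aa'| * |(T *ᵥ Vu x' - Vu x) i|) = |aa'| * (wt * |(T *ᵥ Vu x' - Vu x) i|) := by ring
        _ ≤ 1 * (c₂ * Real.exp (-(DA / K₂)) * φ) :=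
            mul_le_mul haa1 hH (mul_nonneg hwt0 (abs_nonneg _)) zero_le_one
        _ ≤ c₂ * (Real.exp (4 / K) * FF) * φ := by
            rw [one_mul]
            exact mul_le_mul_of_nonneg_right (mul_le_mul_of_nonneg_left (hexpA hDb3 K₂ hK₂1 hK₂K) hc₂.le) hφ
        _ = c₂ * Real.exp (4 / K) * FF * φ := by ring
    -- (B)
    have hB : wt * |(aa' - aa) * Vu x i| ≤ 8 * ((d : ℝ) + 1) * cd * Real.exp (4 / K) * FF * φ := by
      by_cases h0 : aa' - aa = 0
      · rw [h0, zero_mul, abs_zero, mul_zero]; positivity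
      have hne1 : χv xp ≠ 1 ∨ χv xp' ≠ 1 := by
        by_contra hc; push Not at hc
        exact h0 (by rw [haa, haa', hhh]; simp only [hc.1, hc.2, sub_self])
      obtain ⟨hDb3, hfarc, -⟩ := hbook (by
        rcases hne1 with h | h
        · exact hwit xp hnxp h
        · exact hwit xp' hnxp' h)
      have hDcP : ∀ x'', P x'' → ∃ μ, Dc ≤ |posR ℓ k Ms x μ - posR ℓ k Ms x'' μ| := fun x'' hx'' =>
        exists_coord_of_le_supNorm ℓ k Ms x x'' (hfarc x'' hx'')
      have hDu := DΩ ν x hxν P Dc hDcP f hfP φ hφ hf i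
      have hlip : |aa' - aa| ≤ 8 * ((d : ℝ) + 1) * sN / (((ℓ + 1) ^ k : ℕ) : ℝ) := by
        have := abs_chi_sub_le Ms Mb (fun i => (o i : ℤ)) hn (y := xp.1) (y' := xp'.1) xp.2 xp'.2
        rw [hxpxp'] at this
        rw [haa, haa', hhh]
        rw [show (1 - χv xp') - (1 - χv xp) = -(χv xp' - χv xp) by ring, abs_neg]
        exact this
      rw [abs_mul]
      have hVu : |Vu x i| ≤ cd * Real.exp (-(Dc / K₄)) * φ := by rw [hVu, fld_apply]; exact hDu
      calc wt * (|aa' - aa| * |Vu x i|)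
          ≤ wt * (8 * ((d : ℝ) + 1) * sN / (((ℓ + 1) ^ k : ℕ) : ℝ) * (cd * Real.exp (-(Dc / K₄)) * φ)) :=
            mul_le_mul_of_nonneg_left (mul_le_mul hlip hVu (abs_nonneg _) (by positivity)) hwt0
        _ = (wt * (sN / (((ℓ + 1) ^ k : ℕ) : ℝ))) * (8 * ((d : ℝ) + 1)) * (cd * Real.exp (-(Dc / K₄)) * φ) := by
            ring
        _ ≤ 1 * (8 * ((d : ℝ) + 1)) * (cd * (Real.exp (4 / K) * FF) * φ) := by
            refine mul_le_mul (mul_le_mul_of_nonneg_right hwle (by positivity)) ?_ (by positivity) (by positivity)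
            exact mul_le_mul_of_nonneg_right (mul_le_mul_of_nonneg_left (hexpc hDb3 K₄ hK₄1 hK₄K) hcd.le) hφ
        _ = 8 * ((d : ℝ) + 1) * cd * Real.exp (4 / K) * FF * φ := by ring
    -- (C)
    have hC : wt * |bb' * (T *ᵥ Uu x' - Uu x) i|
        ≤ 8 * ((d : ℝ) + 1) * Real.sqrt (Fintype.card ι) * cd * Real.exp (4 / K) * FF * φ := by
      by_cases h0 : bb' = 0
      · rw [h0, zero_mul, abs_zero, mul_zero]; positivity
      have hne1 : χv x' ≠ 1 ∨ χv xp' ≠ 1 := by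
        by_contra hc; push Not at hc
        exact h0 (by rw [hbb', hhh]; simp only [hc.1, hc.2, sub_self, mul_zero])
      obtain ⟨hDb3, -, hfarA⟩ := hbook (by
        rcases hne1 with h | h
        · exact hwit x' hnx' h
        · exact hwit xp' hnxp' h)
      have hbb8 : |bb'| ≤ 8 := by
        have hmem : xp' ∈ boxNbrs (fun j => (ℓ + 1) ^ k * Ms j) x' := by
          unfold boxNbrs; simpa using (mem_nbrs.2 ⟨ν, Or.inl rfl⟩ : xp'.1 ∈ nbrs x'.1)
        have := hsz.grad_le x' xp' hmem
        rw [hbb', hhh, show (1 - χv xp') - (1 - χv x') = -(χv xp' - χv x') by ring, mul_neg, abs_neg, abs_mul,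
          abs_of_nonneg hnr.le]
        exact this
      -- the derivative member on the chain sites
      set BD : ℝ := Real.sqrt (Fintype.card ι) * (cd * Real.exp (-(DA / K₄)) * φ) with hBD
      have hBD0 : 0 ≤ BD := by positivity
      have hchain : ∀ z : ↥(Box d ℓ k Ms), (z = x ∨ z ∈ l) → ∀ (μ' : Fin (d + 1)) (ze : ↥(Box d ℓ k Ms)),
          ze.1 = z.1 + e1 μ' → siteNorm (fieldLink F κ AΩ z ze *ᵥ fld u ze - fld u z) ≤ BD / (((ℓ + 1) ^ k : ℕ) : ℝ) := by
        intro z hz μ' ze hze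
        have hzx : supNorm (x.1 - z.1) ≤ (((ℓ + 1) ^ k : ℕ) : ℝ) := by
          rcases hz with rfl | hz
          · rw [sub_self, B4BoxCov237.supNorm_zero']; exact hnr.le
          · rw [supNorm_sub_comm]; exact (hlnear z hz).trans hfar
        have hzμ : z.1 + e1 μ' ∈ Box d ℓ k Ms := by rw [← hze]; exact ze.2
        have hDAz : ∀ x'', P x'' → ∃ μ, DA ≤ |posR ℓ k Ms z μ - posR ℓ k Ms x'' μ| := fun x'' hx'' =>
          exists_coord_of_le_supNorm ℓ k Ms z x'' (hfarA z hzx x'' hx'')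
        have hDz := DΩ μ' z hzμ P DA hDAz f hfP φ hφ hf
        have hcov : fld (derivA d F κ ℓ k Ms AΩ μ' *ᵥ u) z
            = (((ℓ + 1) ^ k : ℕ) : ℝ) • (fieldLink F κ AΩ z ze *ᵥ fld u ze - fld u z) := by
          have := fld_covDeriv_mulVec_of_mem ((ℓ + 1) ^ k) (fieldLink F κ AΩ) (μ := μ') u (x := z) hzμ
          have hze' : ze = ⟨z.1 + e1 μ', hzμ⟩ := Subtype.ext hze
          rw [hze']
          exact_mod_cast this
        have hnorm : siteNorm (fld (derivA d F κ ℓ k Ms AΩ μ' *ᵥ u) z) ≤ BD := by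
          refine (B4Thm112BoxValue.siteNorm_le_sqrt_card_mul _ (by positivity) fun j => ?_)
          rw [fld_apply]
          exact hDz j
        rw [hcov, siteNorm_smul, abs_of_nonneg hnr.le] at hnorm
        rw [le_div_iff₀ hnr, mul_comm]
        exact hnorm
      have htel := chain_covariation_local F κ hAas u x l hl hchain
      rw [hlend] at htel
      have hcomp : |(T *ᵥ Uu x' - Uu x) i| ≤ (l.length : ℝ) * (BD / (((ℓ + 1) ^ k : ℕ) : ℝ)) := by
        refine (B4Thm112BoxValue.abs_apply_le_siteNorm' _ i).trans ?_
        rw [hUu, hT]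
        exact htel
      rw [abs_mul]
      calc wt * (|bb'| * |(T *ᵥ Uu x' - Uu x) i|)
          ≤ wt * (8 * ((l.length : ℝ) * (BD / (((ℓ + 1) ^ k : ℕ) : ℝ)))) :=
            mul_le_mul_of_nonneg_left (mul_le_mul hbb8 hcomp (abs_nonneg _) (by norm_num)) hwt0
        _ ≤ wt * (8 * ((((d : ℝ) + 1) * sN) * (BD / (((ℓ + 1) ^ k : ℕ) : ℝ)))) := by
            refine mul_le_mul_of_nonneg_left (mul_le_mul_of_nonneg_left ?_ (by norm_num)) hwt0
            exact mul_le_mul_of_nonneg_right hlen (by positivity)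
        _ = (wt * (sN / (((ℓ + 1) ^ k : ℕ) : ℝ))) * (8 * ((d : ℝ) + 1)) * BD := by ring
        _ ≤ 1 * (8 * ((d : ℝ) + 1)) * (Real.sqrt (Fintype.card ι) * (cd * (Real.exp (4 / K) * FF) * φ)) := by
            refine mul_le_mul (mul_le_mul_of_nonneg_right hwle (by positivity)) ?_ hBD0 (by positivity)
            rw [hBD]
            refine mul_le_mul_of_nonneg_left ?_ (Real.sqrt_nonneg _)
            exact mul_le_mul_of_nonneg_right (mul_le_mul_of_nonneg_left (hexpA hDb3 K₄ hK₄1 hK₄K) hcd.le) hφ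
        _ = 8 * ((d : ℝ) + 1) * Real.sqrt (Fintype.card ι) * cd * Real.exp (4 / K) * FF * φ := by ring
    -- (D)
    have hDD : wt * |(bb' - bb) * Uu x i| ≤ 128 * ((d : ℝ) + 1) * cv * Real.exp (4 / K) * FF * φ := by
      by_cases h0 : bb' - bb = 0
      · rw [h0, zero_mul, abs_zero, mul_zero]; positivity
      have hne1 : (χv x ≠ 1 ∨ χv xp ≠ 1) ∨ (χv x' ≠ 1 ∨ χv xp' ≠ 1) := by
        by_contra hc; push Not at hc
        exact h0 (by rw [hbb, hbb', hhh]; simp only [hc.1.1, hc.1.2, hc.2.1, hc.2.2, sub_self, mul_zero])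
      obtain ⟨hDb3, hfarc, -⟩ := hbook (by
        rcases hne1 with (h | h) | (h | h)
        · exact hwit x hnx h
        · exact hwit xp hnxp h
        · exact hwit x' hnx' h
        · exact hwit xp' hnxp' h)
      have hDcP : ∀ x'', P x'' → ∃ μ, Dc ≤ |posR ℓ k Ms x μ - posR ℓ k Ms x'' μ| := fun x'' hx'' =>
        exists_coord_of_le_supNorm ℓ k Ms x x'' (hfarc x'' hx'')
      have hux := VΩ x P Dc hDcP f hfP φ hφ hf i
      have hlip : |bb' - bb| ≤ 128 * ((d : ℝ) + 1) * sN / (((ℓ + 1) ^ k : ℕ) : ℝ) := by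
        have := abs_dchi_sub_le Ms Mb (fun i => (o i : ℤ)) hn ν (y := x.1) (ye := xp.1) (y' := x'.1)
          (ye' := xp'.1) x.2 xp.2 x'.2 xp'.2 (by simp [hxp, e1]) (by simp [hxp', e1])
        rw [← hsN] at this
        rw [hbb, hbb', hhh]
        rw [show (((ℓ + 1) ^ k : ℕ) : ℝ) * ((1 - χv xp') - (1 - χv x')) - (((ℓ + 1) ^ k : ℕ) : ℝ) * ((1 - χv xp) - (1 - χv x))
            = -((((ℓ + 1) ^ k : ℕ) : ℝ) * (χv xp' - χv x') - (((ℓ + 1) ^ k : ℕ) : ℝ) * (χv xp - χv x)) by ring,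
          abs_neg]
        exact this
      have hUx : |Uu x i| ≤ cv * Real.exp (-(Dc / K₃)) * φ := by rw [hUu, fld_apply]; exact hux
      rw [abs_mul]
      calc wt * (|bb' - bb| * |Uu x i|)
          ≤ wt * (128 * ((d : ℝ) + 1) * sN / (((ℓ + 1) ^ k : ℕ) : ℝ) * (cv * Real.exp (-(Dc / K₃)) * φ)) :=
            mul_le_mul_of_nonneg_left (mul_le_mul hlip hUx (abs_nonneg _) (by positivity)) hwt0
        _ = (wt * (sN / (((ℓ + 1) ^ k : ℕ) : ℝ))) * (128 * ((d : ℝ) + 1)) * (cv * Real.exp (-(Dc / K₃)) * φ) := by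
            ring
        _ ≤ 1 * (128 * ((d : ℝ) + 1)) * (cv * (Real.exp (4 / K) * FF) * φ) := by
            refine mul_le_mul (mul_le_mul_of_nonneg_right hwle (by positivity)) ?_ (by positivity) (by positivity)
            exact mul_le_mul_of_nonneg_right (mul_le_mul_of_nonneg_left (hexpc hDb3 K₃ hK₃1 hK₃K) hcv.le) hφ
        _ = 128 * ((d : ℝ) + 1) * cv * Real.exp (4 / K) * FF * φ := by ring
    -- sum
    have hsum : |aa' * (T *ᵥ Vu x' - Vu x) i + (aa' - aa) * Vu x i + bb' * (T *ᵥ Uu x' - Uu x) i + (bb' - bb) * Uu x i|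
        ≤ |aa' * (T *ᵥ Vu x' - Vu x) i| + |(aa' - aa) * Vu x i| + |bb' * (T *ᵥ Uu x' - Uu x) i|
          + |(bb' - bb) * Uu x i| := by
      refine (abs_add_le _ _).trans (add_le_add ((abs_add_le _ _).trans (add_le_add (abs_add_le _ _) le_rfl)) le_rfl)
    calc wt * |aa' * (T *ᵥ Vu x' - Vu x) i + (aa' - aa) * Vu x i + bb' * (T *ᵥ Uu x' - Uu x) i + (bb' - bb) * Uu x i|
        ≤ wt * (|aa' * (T *ᵥ Vu x' - Vu x) i| + |(aa' - aa) * Vu x i| + |bb' * (T *ᵥ Uu x' - Uu x) i|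
          + |(bb' - bb) * Uu x i|) := mul_le_mul_of_nonneg_left hsum hwt0
      _ = wt * |aa' * (T *ᵥ Vu x' - Vu x) i| + wt * |(aa' - aa) * Vu x i| + wt * |bb' * (T *ᵥ Uu x' - Uu x) i|
          + wt * |(bb' - bb) * Uu x i| := by ring
      _ ≤ c₂ * Real.exp (4 / K) * FF * φ + 8 * ((d : ℝ) + 1) * cd * Real.exp (4 / K) * FF * φ
          + 8 * ((d : ℝ) + 1) * Real.sqrt (Fintype.card ι) * cd * Real.exp (4 / K) * FF * φ
          + 128 * ((d : ℝ) + 1) * cv * Real.exp (4 / K) * FF * φ :=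
          add_le_add (add_le_add (add_le_add hA hB) hC) hDD
      _ = cT1 * FF * φ := by rw [hcT1]; ring
  ---------------------------------------------------------------- T2'' : the commutator term, annular bound
  have hT2 : wt * |(T *ᵥ W2 ex' - W2 ex) i| ≤ c₂ * Real.exp (1 / K) * CK * Real.exp (4 / K) / (1 - r) * FF * φ := by
    -- the source facts
    have hval : ∀ (a'' : ↥(Box d ℓ k Ms)) (D' : ℝ), 0 ≤ D' →
        (∀ x'', P x'' → D' * (((ℓ + 1) ^ k : ℕ) : ℝ) ≤ supNorm (a''.1 - x''.1)) →
        ∀ j, |u (a'', j)| ≤ cv * Real.exp (-(D' / K)) * φ := by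
      intro a'' D' hD'0 hD'' j
      have := VΩ a'' P D' (fun x'' hx'' => exists_coord_of_le_supNorm ℓ k Ms a'' x'' (hD'' x'' hx'')) f hfP φ hφ hf j
      exact this.trans (mul_le_mul_of_nonneg_right (mul_le_mul_of_nonneg_left (hmono K₃ hK₃1 hK₃K hD'0) hcv.le) hφ)
    have hder : ∀ (a'' : ↥(Box d ℓ k Ms)) (μ : Fin (d + 1)), a''.1 + e1 μ ∈ Box d ℓ k Ms → ∀ (D' : ℝ), 0 ≤ D' →
        (∀ x'', P x'' → D' * (((ℓ + 1) ^ k : ℕ) : ℝ) ≤ supNorm (a''.1 - x''.1)) →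
        ∀ j, |(derivA d F κ ℓ k Ms AΩ μ *ᵥ u) (a'', j)| ≤ cd * Real.exp (-(D' / K)) * φ := by
      intro a'' μ hμ D' hD'0 hD'' j
      have := DΩ μ a'' hμ P D' (fun x'' hx'' => exists_coord_of_le_supNorm ℓ k Ms a'' x'' (hD'' x'' hx''))
        f hfP φ hφ hf j
      exact this.trans (mul_le_mul_of_nonneg_right (mul_le_mul_of_nonneg_left (hmono K₄ hK₄1 hK₄K hD'0) hcd.le) hφ)
    have hsrc := source_facts ℓ k Mb Ms o F κ ho hℓ hk hn hMs ha ha1 ha2 m2 Ac' u x P hcv.le hcd.le hφ hDx hDbx hDfx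
      hval hder
    -- the functional and its row bound
    set R : (↥(Box d ℓ k Mb) × ι → ℝ) → ℝ := fun src =>
      wt * ((T *ᵥ fld (Dν₀ *ᵥ (G₀ *ᵥ src)) ex') i - fld (Dν₀ *ᵥ (G₀ *ᵥ src)) ex i) with hR
    have hRsum : ∀ (s : Finset ℕ) (v : ℕ → ↥(Box d ℓ k Mb) × ι → ℝ), R (∑ m ∈ s, v m) = ∑ m ∈ s, R (v m) := by
      intro s v
      simp only [hR, Matrix.mulVec_sum, fld_sum', Finset.sum_apply, ← Finset.mul_sum, Finset.sum_sub_distrib]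
    have hRrow : ∀ (Pm : ↥(Box d ℓ k Mb) → Prop) [DecidablePred Pm] (m : ℕ),
        (∀ y, Pm y → (m : ℝ) * (((ℓ + 1) ^ k : ℕ) : ℝ) ≤ supNorm ((subEmb ℓ k Mb Ms o ho x).1 - y.1)) →
        ∀ src : ↥(Box d ℓ k Mb) × ι → ℝ, (∀ q, ¬ Pm q.1 → src q = 0) → ∀ φ' : ℝ, 0 ≤ φ' →
        (∀ q, |src q| ≤ φ') → |R src| ≤ c₂ * Real.exp (1 / K) * Real.exp (-((m : ℝ) / K)) * φ' := by
      intro Pm _ m hPm src hsupp φ' hφ' hbd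
      set Dm : ℝ := max ((m : ℝ) - 1) 0 with hDm
      have hDm0 : 0 ≤ Dm := le_max_right _ _
      have hDmx : ∀ y, Pm y → ∃ μ, Dm ≤ |posR ℓ k Mb ex μ - posR ℓ k Mb y μ| := by
        intro y hy
        refine exists_coord_of_le_supNorm ℓ k Mb ex y ?_
        have h1 : (m : ℝ) * (((ℓ + 1) ^ k : ℕ) : ℝ) ≤ supNorm (ex.1 - y.1) := hPm y hy
        rw [hDm]
        rcases le_total ((m : ℝ) - 1) 0 with hc | hc
        · rw [max_eq_right hc, zero_mul]; exact supNorm_nonneg _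
        · rw [max_eq_left hc, sub_mul, one_mul]; linarith only [h1, hnr.le]
      have hDmx' : ∀ y, Pm y → ∃ μ, Dm ≤ |posR ℓ k Mb ex' μ - posR ℓ k Mb y μ| := by
        intro y hy
        refine exists_coord_of_le_supNorm ℓ k Mb ex' y ?_
        have t1 := supNorm_sub_le_sub_add_sub ex.1 ex'.1 y.1
        have t2 : supNorm (ex.1 - ex'.1) = sN := by rw [supNorm_sub_comm]; exact hsNe
        rw [t2] at t1
        have h1 : (m : ℝ) * (((ℓ + 1) ^ k : ℕ) : ℝ) ≤ supNorm (ex.1 - y.1) := hPm y hy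
        rw [hDm]
        rcases le_total ((m : ℝ) - 1) 0 with hc | hc
        · rw [max_eq_right hc, zero_mul]; exact supNorm_nonneg _
        · rw [max_eq_left hc, sub_mul, one_mul]; linarith only [t1, h1, hfar]
      have hH := HΩ₀ ν ex ex' (subEmb_add_e1_mem ℓ k Mb Ms o ho x ν hxν) (subEmb_add_e1_mem ℓ k Mb Ms o ho x' ν hx'ν)
        hexne (l.map (subEmb ℓ k Mb Ms o ho)) hle' hlend' hlen' hlnear' Pm Dm hDm0 hDmx hDmx' src hsupp φ' hφ' hbd i
      rw [hTe, hsNe] at hH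
      have hexp : Real.exp (-(Dm / K₂)) ≤ Real.exp (1 / K) * Real.exp (-((m : ℝ) / K)) := by
        refine (hmono K₂ hK₂1 hK₂K hDm0).trans ?_
        rw [← Real.exp_add, Real.exp_le_exp]
        have : (m : ℝ) - 1 ≤ Dm := le_max_left _ _
        rw [show 1 / (K : ℝ) + -((m : ℝ) / K) = (-(m - 1)) / K by ring, show -(Dm / (K : ℝ)) = (-Dm) / K by ring]
        exact div_le_div_of_nonneg_right (by linarith only [this]) hKr.le
      rw [hR, abs_mul, abs_of_nonneg hwt0]
      calc wt * |(T *ᵥ fld (Dν₀ *ᵥ (G₀ *ᵥ src)) ex') i - fld (Dν₀ *ᵥ (G₀ *ᵥ src)) ex i|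
          = wt * |(T *ᵥ fld (Dν₀ *ᵥ (G₀ *ᵥ src)) ex' - fld (Dν₀ *ᵥ (G₀ *ᵥ src)) ex) i| := by
            rw [Pi.sub_apply]
        _ ≤ c₂ * Real.exp (-(Dm / K₂)) * φ' := hH
        _ ≤ c₂ * (Real.exp (1 / K) * Real.exp (-((m : ℝ) / K))) * φ' :=
            mul_le_mul_of_nonneg_right (mul_le_mul_of_nonneg_left hexp hc₂.le) hφ'
        _ = c₂ * Real.exp (1 / K) * Real.exp (-((m : ℝ) / K)) * φ' := by ring
    have hann := annular_bound ℓ k Mb Ms o ho x g R hRsum hKr (by positivity : 0 ≤ c₂ * Real.exp (1 / K)) hCK0 hφ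
      (fun m => max (max (D - m - 2) (Df - 3)) 0)
      (fun m => by
        show ((D - (m : ℝ) - 2) + (Df - 3)) / 2 ≤ max (max (D - (m : ℝ) - 2) (Df - 3)) 0
        have h1 : D - m - 2 ≤ max (max (D - (m : ℝ) - 2) (Df - 3)) 0 := (le_max_left _ _).trans (le_max_left _ _)
        have h2 : Df - 3 ≤ max (max (D - (m : ℝ) - 2) (Df - 3)) 0 := (le_max_right _ _).trans (le_max_left _ _)
        linarith only [h1, h2])
      hRrow hsrc
    have hRg : R (extV ℓ k Mb Ms o g) = wt * (T *ᵥ W2 ex' - W2 ex) i := by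
      simp only [hR, hW2, Pi.sub_apply]
    rw [hRg, abs_mul, abs_of_nonneg hwt0] at hann
    simpa only [hr] using hann
  ---------------------------------------------------------------- T3'' : the cut source term
  have hT3 : wt * |(T *ᵥ W3 ex' - W3 ex) i| ≤ c₂ * Real.exp (2 / K) * FF * φ := by
    have hf₃v : ∀ q, f₃ q = (1 - χv q.1) * f q := fun q => mulH_mulVec_apply _ _ q
    by_cases hP3 : ∃ a₀, P a₀ ∧ χv a₀ ≠ 1
    · obtain ⟨a₀, ha₀P, ha₀χ⟩ := hP3
      obtain ⟨y₀, hy₀, hd₀⟩ := exists_out_of_chi_ne_one ℓ k Mb Ms o ho hn2 hMs a₀ ha₀χ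
      have hDf1 : Df ≤ 1 := by
        have := (hDfx a₀ ha₀P y₀ hy₀).trans hd₀
        exact le_of_mul_le_mul_right (by linarith only [this]) hnr
      set D₃ : ℝ := max ((D + (Db - 1)) / 2 - 1) 0 with hD₃
      have hD₃0 : 0 ≤ D₃ := le_max_right _ _
      set P₃ : ↥(Box d ℓ k Mb) → Prop := fun y => ∃ a', subEmb ℓ k Mb Ms o ho a' = y ∧ P a' ∧ χv a' ≠ 1 with hP₃
      haveI hP₃d : DecidablePred P₃ := Classical.decPred P₃
      have hP₃dist : ∀ y, P₃ y → max ((D + (Db - 1)) / 2) 0 * (((ℓ + 1) ^ k : ℕ) : ℝ) ≤ supNorm (ex.1 - y.1) := by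
        rintro y ⟨a', rfl, ha'P, ha'χ⟩
        obtain ⟨y', hy', hd'⟩ := exists_out_of_chi_ne_one ℓ k Mb Ms o ho hn2 hMs a' ha'χ
        refine max_half_mul_le hnr.le ?_ ?_ (supNorm_nonneg _)
        · rw [hex, supNorm_subEmb_sub_subEmb]; exact hDx a' ha'P
        · have t1 := supNorm_sub_le_sub_add_sub ex.1 (subEmb ℓ k Mb Ms o ho a').1 y'.1
          have := hDbx y' hy'
          rw [sub_mul, one_mul]
          linarith only [t1, this, hd']
      have hD₃le : ∀ s' : ℝ, max ((D + (Db - 1)) / 2) 0 * (((ℓ + 1) ^ k : ℕ) : ℝ) - (((ℓ + 1) ^ k : ℕ) : ℝ) ≤ s' →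
          0 ≤ s' → D₃ * (((ℓ + 1) ^ k : ℕ) : ℝ) ≤ s' := by
        intro s' h1 h0
        rw [hD₃]
        rcases le_total ((D + (Db - 1)) / 2 - 1) 0 with hc | hc
        · rw [max_eq_right hc, zero_mul]; exact h0
        · rw [max_eq_left hc]
          have : max ((D + (Db - 1)) / 2) 0 = (D + (Db - 1)) / 2 := max_eq_left (by linarith only [hc])
          rw [this] at h1
          rw [sub_mul, one_mul]; exact h1
      have hD₃P : ∀ y, P₃ y → ∃ μ, D₃ ≤ |posR ℓ k Mb ex μ - posR ℓ k Mb y μ| := fun y hy =>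
        exists_coord_of_le_supNorm ℓ k Mb ex y
          (hD₃le _ (by linarith only [hP₃dist y hy, hnr.le]) (supNorm_nonneg _))
      have hD₃P' : ∀ y, P₃ y → ∃ μ, D₃ ≤ |posR ℓ k Mb ex' μ - posR ℓ k Mb y μ| := by
        intro y hy
        refine exists_coord_of_le_supNorm ℓ k Mb ex' y (hD₃le _ ?_ (supNorm_nonneg _))
        have t1 := supNorm_sub_le_sub_add_sub ex.1 ex'.1 y.1
        have t2 : supNorm (ex.1 - ex'.1) = sN := by rw [supNorm_sub_comm]; exact hsNe
        rw [t2] at t1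
        linarith only [t1, hP₃dist y hy, hfar]
      have hsupp : ∀ q : ↥(Box d ℓ k Mb) × ι, ¬ P₃ q.1 → extV ℓ k Mb Ms o f₃ q = 0 := by
        intro q hq
        by_cases hqi : inSub ℓ k Mb Ms o q.1
        · obtain ⟨a', ha'⟩ := (inSub_iff ℓ k Mb Ms o ho _).mp hqi
          have hq' : q = (subEmb ℓ k Mb Ms o ho a', q.2) := Prod.ext ha'.symm rfl
          rw [hq', extV_subEmb, hf₃v]
          by_cases hPa : P a'
          · have hχa : χv a' = 1 := by
              by_contra hc; exact hq ⟨a', ha', hPa, hc⟩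
            simp only [hχa, sub_self, zero_mul]
          · rw [hfP (a', q.2) hPa, mul_zero]
        · exact extV_of_not_inSub ℓ k Mb Ms o f₃ hqi
      have hbd : ∀ q : ↥(Box d ℓ k Mb) × ι, |extV ℓ k Mb Ms o f₃ q| ≤ φ := by
        intro q
        by_cases hqi : inSub ℓ k Mb Ms o q.1
        · obtain ⟨a', ha'⟩ := (inSub_iff ℓ k Mb Ms o ho _).mp hqi
          have hq' : q = (subEmb ℓ k Mb Ms o ho a', q.2) := Prod.ext ha'.symm rfl
          rw [hq', extV_subEmb, hf₃v, abs_mul]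
          obtain ⟨h0, h1⟩ := hχ01 a'
          calc |1 - χv a'| * |f (a', q.2)| ≤ 1 * φ :=
                mul_le_mul (by rw [abs_of_nonneg (by linarith only [h1])]; linarith only [h0]) (hf _)
                  (abs_nonneg _) zero_le_one
            _ = φ := one_mul φ
        · rw [extV_of_not_inSub ℓ k Mb Ms o f₃ hqi, abs_zero]; exact hφ
      have h3 := HΩ₀ ν ex ex' (subEmb_add_e1_mem ℓ k Mb Ms o ho x ν hxν) (subEmb_add_e1_mem ℓ k Mb Ms o ho x' ν hx'ν)
        hexne (l.map (subEmb ℓ k Mb Ms o ho)) hle' hlend' hlen' hlnear' P₃ D₃ hD₃0 hD₃P hD₃P' (extV ℓ k Mb Ms o f₃)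
        hsupp φ hφ hbd i
      rw [hTe, hsNe] at h3
      have hexp : Real.exp (-(D₃ / K₂)) ≤ Real.exp (2 / K) * FF :=
        (hmono K₂ hK₂1 hK₂K hD₃0).trans (exp_bookkeeping hKr (by
          have : (D + (Db - 1)) / 2 - 1 ≤ D₃ := le_max_left _ _
          linarith only [this, hDf1]))
      calc wt * |(T *ᵥ W3 ex' - W3 ex) i| = wt * |(T *ᵥ W3 ex' - W3 ex) i| := rfl
        _ ≤ c₂ * Real.exp (-(D₃ / K₂)) * φ := by rw [hW3]; exact h3
        _ ≤ c₂ * (Real.exp (2 / K) * FF) * φ :=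
            mul_le_mul_of_nonneg_right (mul_le_mul_of_nonneg_left hexp hc₂.le) hφ
        _ = c₂ * Real.exp (2 / K) * FF * φ := by ring
    · push Not at hP3
      have hf₃0 : f₃ = 0 := by
        funext q
        rw [hf₃v]
        by_cases hPq : P q.1
        · rw [hP3 q.1 hPq, sub_self, zero_mul]; rfl
        · rw [hfP q hPq, mul_zero]; rfl
      have hE0 : extV ℓ k Mb Ms o f₃ = 0 := by
        funext q; rw [hf₃0]; simp [extV]
      have hW30 : W3 = fun _ => 0 := by
        rw [hW3, hE0, Matrix.mulVec_zero, Matrix.mulVec_zero]; funext z; funext j; simp [fld_apply]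
      rw [hW30, Matrix.mulVec_zero, sub_zero, Pi.zero_apply, abs_zero, mul_zero]
      positivity
  ---------------------------------------------------------------- total
  have htot : wt * |(T *ᵥ V1 x' - V1 x) i - (T *ᵥ W2 ex' - W2 ex) i - (T *ᵥ W3 ex' - W3 ex) i|
      ≤ cT1 * FF * φ + c₂ * Real.exp (1 / K) * CK * Real.exp (4 / K) / (1 - r) * FF * φ + c₂ * Real.exp (2 / K) * FF * φ := by
    have h := abs_sub (((T *ᵥ V1 x' - V1 x) i - (T *ᵥ W2 ex' - W2 ex) i)) ((T *ᵥ W3 ex' - W3 ex) i)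
    have h' := abs_sub ((T *ᵥ V1 x' - V1 x) i) ((T *ᵥ W2 ex' - W2 ex) i)
    have := mul_le_mul_of_nonneg_left (h.trans (add_le_add h' le_rfl)) hwt0
    refine this.trans ?_
    rw [mul_add, mul_add]
    exact add_le_add (add_le_add hT1 hT2) hT3
  refine htot.trans ?_
  have : cT1 * FF * φ + c₂ * Real.exp (1 / K) * CK * Real.exp (4 / K) / (1 - r) * FF * φ + c₂ * Real.exp (2 / K) * FF * φ
      = (cT1 + c₂ * Real.exp (1 / K) * CK * Real.exp (4 / K) / (1 - r) + c₂ * Real.exp (2 / K)) * FF * φ := by ring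
  rw [this, hFF]
  refine mul_le_mul_of_nonneg_right (mul_le_mul_of_nonneg_right ?_ hFF0.le) hφ
  rw [hcH]
  have : 0 ≤ ((Fintype.card ι : ℝ) + 1) * c₁ := by positivity
  linarith only [this]

/-- **THEOREM p. 573, THE `δG` CLAUSE (1.11)–(1.12), HÖLDER MEMBER, ON EVERY NESTED PAIR OF BOXES, ALL PAIRS `x ≠ x′`,
WITH ONLY «e SUFFICIENTLY SMALL»**.  For `0 ≤ α < 1` there are `K` (`16 ≤ K`, `4 ∣ K`) and `c_H > 0` (depending on
`d`, `ℓ`, `N`, `α`, the flow and the windows only) such that for every `(c, β)` (`β > 0`) there is `e₁ > 0` with: for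
every scale `k ≥ 1`, `a ∈ [a₋,a₊]`, `m² ∈ [0,m²₊]`, every pair of boxes `Ω = n·o + Π[0,nMs) ⊂ Ω₀ = Π[0,nMb)` with
unit sides multiples of `K`, every component field `A_c`, (1.7)-regular on `Ω₀` and constant on the `K`-collars of `Ω₀`
and of `Ω`, every `0 < e ≤ e₁` (coupling `e/n`), every direction `ν` and sites `x ≠ x′` with
`⟨x,x+ηe_ν⟩, ⟨x′,x′+ηe_ν⟩ ⊂ Ω`, every nearest-neighbour chain `Γ` of `Ω` from `x` to `x′` with `|Γ| ≤ (d+1)|x′−x|_∞`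
inside the `|x′−x|_∞`-ball about `x`, every source `f` on `Ω` supported in `P` with `|f| ≤ φ`, and all
`D, D_b, D_f ≥ 0` below the unit-lattice sup-distances from both `x, x′` to `P`, from both `x, x′` to `Ω₀ ∖ Ω`, and
from `P` to `Ω₀ ∖ Ω`: with `δ = G_k(Ω,A|Ω)f − (G_k(Ω₀,A)Ef)|Ω`,
`(n/|x′−x|_∞)^α·|U(A(Γ))(D^η_{A,ν}δ)(x′) − (D^η_{A,ν}δ)(x)|_i ≤ c_H·exp(−(D + D_b + D_f)/(2K))·φ`.
[cite: Balaban1983RegularityDecay, Theorem (1.9), (1.11)–(1.12) p.573; p.579] -/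
theorem thm112_holder_box_uniform (F : OrthFlow ι) {ℓ₁ : ℝ} (hℓ₁ : 0 ≤ ℓ₁)
    (hLip : ∀ t (v : ι → ℝ), ((F.U t - 1) *ᵥ v) ⬝ᵥ ((F.U t - 1) *ᵥ v) ≤ (ℓ₁ * t) ^ 2 * (v ⬝ᵥ v))
    (d ℓ : ℕ) (hd : 1 ≤ d) (hℓ : 1 ≤ ℓ) (amin aplus m2plus : ℝ) (ha : 0 < amin) (α : ℝ) (hα0 : 0 ≤ α)
    (hα1 : α < 1) :
    ∃ K : ℕ, 16 ≤ K ∧ 4 ∣ K ∧ ∃ cH : ℝ, 0 < cH ∧ ∀ (creg β : ℝ), 0 ≤ creg → 0 < β →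
      ∃ e₁ : ℝ, 0 < e₁ ∧ ∀ (k : ℕ), 1 ≤ k → ∀ (hn : 1 ≤ (ℓ + 1) ^ k) (a m2 : ℝ),
      amin ≤ a → a ≤ aplus → 0 ≤ m2 → m2 ≤ m2plus →
      ∀ (Mb Ms o : Fin (d + 1) → ℕ) (ho : ∀ i, o i + Ms i ≤ Mb i), (∀ i, 1 ≤ Ms i) → (∀ μ, K ∣ Mb μ) →
        (∀ μ, K ∣ Ms μ) →
      ∀ (Ac : (Fin (d + 1) → ℤ) → Fin (d + 1) → ℝ) (e : ℝ), 0 < e → e ≤ e₁ →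
        (∀ x ∈ Box d ℓ k Mb, ∀ μ ν : Fin (d + 1),
          |Ac (x + e1 μ) ν - Ac x ν| ≤ creg * e ^ (β - 1) / ((ℓ + 1) ^ k : ℕ)) →
        (∀ w ∈ Box d ℓ k Mb, (∃ μ, w μ < (((ℓ + 1) ^ k : ℕ) : ℤ) * K ∨
            (((ℓ + 1) ^ k : ℕ) : ℤ) * Mb μ < w μ + (((ℓ + 1) ^ k : ℕ) : ℤ) * K) → ∀ ν, Ac w ν = Ac 0 ν) →
        (∀ w ∈ Box d ℓ k Ms, (∃ μ, w μ < (((ℓ + 1) ^ k : ℕ) : ℤ) * K ∨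
            (((ℓ + 1) ^ k : ℕ) : ℤ) * Ms μ < w μ + (((ℓ + 1) ^ k : ℕ) : ℤ) * K) →
          ∀ ν, Ac (w + fun i => (((ℓ + 1) ^ k : ℕ) : ℤ) * (o i : ℤ)) ν
            = Ac (fun i => (((ℓ + 1) ^ k : ℕ) : ℤ) * (o i : ℤ)) ν) →
      ∀ (ν : Fin (d + 1)) (x x' : ↥(Box d ℓ k Ms)), x.1 + e1 ν ∈ Box d ℓ k Ms → x'.1 + e1 ν ∈ Box d ℓ k Ms →
        x'.1 ≠ x.1 →
      ∀ (l : List ↥(Box d ℓ k Ms)), IsNNChain x l → pathEnd x l = x' →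
        (l.length : ℝ) ≤ ((d : ℝ) + 1) * supNorm (x'.1 - x.1) → (∀ z ∈ l, supNorm (z.1 - x.1) ≤ supNorm (x'.1 - x.1)) →
      ∀ (P : ↥(Box d ℓ k Ms) → Prop) [DecidablePred P] (D Db Df : ℝ),
        0 ≤ D → 0 ≤ Db → 0 ≤ Df →
        (∀ x'', P x'' → ∃ μ, D ≤ |posR ℓ k Ms x μ - posR ℓ k Ms x'' μ|) →
        (∀ x'', P x'' → ∃ μ, D ≤ |posR ℓ k Ms x' μ - posR ℓ k Ms x'' μ|) →
        (∀ y : ↥(Box d ℓ k Mb), ¬ inSub ℓ k Mb Ms o y →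
          ∃ μ, Db ≤ |posR ℓ k Mb (subEmb ℓ k Mb Ms o ho x) μ - posR ℓ k Mb y μ|) →
        (∀ y : ↥(Box d ℓ k Mb), ¬ inSub ℓ k Mb Ms o y →
          ∃ μ, Db ≤ |posR ℓ k Mb (subEmb ℓ k Mb Ms o ho x') μ - posR ℓ k Mb y μ|) →
        (∀ x'', P x'' → ∀ y : ↥(Box d ℓ k Mb), ¬ inSub ℓ k Mb Ms o y →
          ∃ μ, Df ≤ |posR ℓ k Mb (subEmb ℓ k Mb Ms o ho x'') μ - posR ℓ k Mb y μ|) →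
      ∀ (f : ↥(Box d ℓ k Ms) × ι → ℝ), (∀ p, ¬ P p.1 → f p = 0) → ∀ (φ : ℝ), 0 ≤ φ → (∀ p, |f p| ≤ φ) →
      ∀ i : ι,
        ((((ℓ + 1) ^ k : ℕ) : ℝ) / supNorm (x'.1 - x.1)) ^ α *
          |(transport (fieldLink F (e / ((ℓ + 1) ^ k : ℕ))
                (fun u v : ↥(Box d ℓ k Ms) =>
                  compField (fun w => Ac (w + fun i => (((ℓ + 1) ^ k : ℕ) : ℤ) * (o i : ℤ))) u.1 v.1)) x l
              *ᵥ fld (derivA d F (e / ((ℓ + 1) ^ k : ℕ)) ℓ k Ms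
                  (fun u v : ↥(Box d ℓ k Ms) =>
                    compField (fun w => Ac (w + fun i => (((ℓ + 1) ^ k : ℕ) : ℤ) * (o i : ℤ))) u.1 v.1) ν
                *ᵥ (greenA d F (e / ((ℓ + 1) ^ k : ℕ)) ℓ k a m2 Ms (baseEmb hn Ms) (stairContour hn Ms)
                      (fun u v : ↥(Box d ℓ k Ms) =>
                        compField (fun w => Ac (w + fun i => (((ℓ + 1) ^ k : ℕ) : ℤ) * (o i : ℤ))) u.1 v.1) *ᵥ f
                    - restrV ℓ k Mb Ms o ho
                      (greenA d F (e / ((ℓ + 1) ^ k : ℕ)) ℓ k a m2 Mb (baseEmb hn Mb) (stairContour hn Mb)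
                        (fun u v : ↥(Box d ℓ k Mb) => compField Ac u.1 v.1) *ᵥ extV ℓ k Mb Ms o f))) x'
            - fld (derivA d F (e / ((ℓ + 1) ^ k : ℕ)) ℓ k Ms
                  (fun u v : ↥(Box d ℓ k Ms) =>
                    compField (fun w => Ac (w + fun i => (((ℓ + 1) ^ k : ℕ) : ℤ) * (o i : ℤ))) u.1 v.1) ν
                *ᵥ (greenA d F (e / ((ℓ + 1) ^ k : ℕ)) ℓ k a m2 Ms (baseEmb hn Ms) (stairContour hn Ms)
                      (fun u v : ↥(Box d ℓ k Ms) =>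
                        compField (fun w => Ac (w + fun i => (((ℓ + 1) ^ k : ℕ) : ℤ) * (o i : ℤ))) u.1 v.1) *ᵥ f
                    - restrV ℓ k Mb Ms o ho
                      (greenA d F (e / ((ℓ + 1) ^ k : ℕ)) ℓ k a m2 Mb (baseEmb hn Mb) (stairContour hn Mb)
                        (fun u v : ↥(Box d ℓ k Mb) => compField Ac u.1 v.1) *ᵥ extV ℓ k Mb Ms o f))) x) i|
          ≤ cH * Real.exp (-((D + Db + Df) / (2 * K))) * φ := by
  obtain ⟨K, hK, h4, H⟩ := thm112_holder_box_uniform_unifK F hℓ₁ hLip d ℓ hd hℓ amin aplus m2plus ha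
  obtain ⟨cH, hcH, H'⟩ := H α hα0 hα1
  exact ⟨K, hK, h4, cH, hcH, H'⟩

end Main

end

end Literature.MathematicalPhysics.QuantumFieldTheory.Balaban1983to89.B4Thm112BoxHolder
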